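import Literature.Probability.RandomPlanarGeometry.SAWPulledLargeForceExpansionZdFourthSymbolEngine
import HarnessLib

/-!
# Pulled SAW on `ℤ^{d+1}`: the FOURTH SYMBOL of the large-force coefficients — the RESPONSE THEOREM for `[d^{k−3}] c_k^{(d)}`

Topic `Literature/Probability/RandomPlanarGeometry` (continues `SAWPulledLargeForceExpansionZdFourthSymbolEngine.lean` — the ENGINE: quadruple symbol
calculus `symbolQuad_one/mul/pow/sub/sum`, the census quadruple `exists_polynomial_costCoeffZd_topFour (t s)` with the two census fourth symbols
`t(c) = [d^{c−3}] c_c(ℤ^d)`, `s(c) = [d^{c−3}] N_{c,c+2}(ℤ^{d+1})` carried as NAMED DATA, and one recursion step `symbolQuad_A_succ (t s)`; and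
`SAWPulledLargeForceExpansionZdThirdSymbol.lean` — CAR F: `exists_symbolTriple_coeff_A`, ★★★ `exists_polynomial_largeForceCoeffZd_secondCoeff`
(`deg_d c_k^{(d)} = k − 1`, `[d^{k−1}] = (−2)^{k−1}`, `[d^{k−2}] = (−1)^{k−1}2^{k−2}(k²−5k+7)`); the tree's cost-series engine `CostSeries.Pz / A / E`,
`largeForceCoeffZd d k = c_k^{(d)} = [X^k] E_k`).

PRINTED CONTEXT (locators only; nothing below is quoted digit-for-digit). Madras–Slade (1993) §1.1 eq. (1.1.8) p. 5 (the `1/d` expansion of `μ`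
after Fisher–Sykes 1959 / Fisher–Gaunt 1964) and §4.2 eq. (4.2.20)–(4.2.22) (cost = length − span of a bridge); Clisby–Liang–Slade (2007) §1.3
eq. (1)/(3) (the expansions of `μ` and of the amplitude `A` in powers of `1/(2d)`). NOT IN PRINT (lane statements): everything below — the objects
`c_k^{(d)}` (large-force coefficients of the pulled self-avoiding walk on `ℤ^{d+1}`) and their `1/d`-symbols are the lane's.

THIS FILE (all PROVED, standard axioms, NO definitions; the census fourth symbols `t`, `s` enter only through the engine's hypotheses `ht`, `hs`,
which NAME coefficients that exist uniquely — no law for them is assumed in PARTS I–IV; PART V takes the two census laws as explicit hypotheses):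
* PART I `Algebra4` — THE FOURTH-ORDER TELESCOPING CERTIFICATE (found by computer algebra, checked by `ring`): with `w = 2Xι`, `ι = (1+2X)⁻¹`,
  `i = 1 − w`, `Σ_{j ≤ K} w^{j+1} G⁽⁴⁾_j(w, i) = A₄(w) + w^{K+2} R₄(K, w)`, `A₄ = 48w³ − 204w⁴ + 384w⁵ − 384w⁶ + 348w⁷ − 288w⁸ + 96w⁹`, `R₄` quartic
  in `K` (`alg4_model_sum`); the generic term of the fourth-symbol recursion at `(ι, θ, κ)` times `96ι⁴` is `w^{j+1}G⁽⁴⁾_j` up to the two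
  exceptional cells `j = 0, 1` where the third census symbol vanishes (`alg4_term`); the CLOSING IDENTITY `96ι²λ₀ + A₄(w) − 96ι⁴(wθ + ¾w²θ) = 0`,
  `λ₀ = −4X⁵(7 + 12X + 60X² + 40X³)ι⁷` (`alg4_close`, a 20-term certificate against `(1+2X)ι = 1`).
* PART II `Step4` — ★★ `alg4_A_step_fourth`: THE FOURTH-ORDER FIXED POINT. If the quadruple of `A_K` is `≡ (ι, θ, κ, Λ_K) (mod X^{K+1})` with
  `θ = 2X²ι³`, `κ = −2X³(1 − 2X + 4X²)ι⁵`, `Λ_K = λ₀ − ι²·T_K`, `T_K = Σ_{c ≤ K} X^c (t(c)[c ≥ 3] ι^{c+1} + s(c)[c ≥ 4] ι^{c+2})` (the census fourth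
  symbols ride as linear PASSENGERS), then the fourth symbol of `A_{K+1}` produced by `symbolQuad_A_succ` is `≡ Λ_{K+1} (mod X^{K+2})`.
* PART III `Inverse4` — the kernels: `Σ_n C(n+r, r)(−2)ⁿXⁿ = ι^{r+1}` (`alg4_iota_pow`), `[X^k] 4X⁵(5+14X+52X²+40X³)ι⁵ =
  (−2)^k(−3k⁴ + 38k³ − 165k² + 214k + 120)/96` for `k ≥ 4` (`alg4_coeff_G`), `[X^k] T_k = Σ_{3 ≤ c ≤ k} t(c)C(k,c)(−2)^{k−c} +
  Σ_{4 ≤ c ≤ k} s(c)C(k+1,c+1)(−2)^{k−c}` (`alg4_coeff_T`); and ★ `alg4_E`: THE FOURTH SYMBOL OF THE INVERSE SERIES `E_k = Σ_{j ≤ k}(1 − A_k)^j`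
  is `≡ −Λ_k/ι² + 2θκ/ι³ − θ³/ι⁴ (mod X^{k+1})` (three geometric sums `alg4_geom2/3/4`), and `−λ₀ι² + 2θκι − θ³ = 4X⁵(5+14X+52X²+40X³)ι⁹`
  (pure ring), so `[X^k]` of it is `[X^k](4X⁵(5+14X+52X²+40X³)ι⁵ + T_k)`.
* PART IV `Assembly4` — ★★ `exists_symbolQuad_coeff_A (t s)`: for every `K` the quadruples of `[X^i] A_K`, `i ≤ K`, are `([X^i]σ_K, [X^i]τ_K, [X^i]υ_K,
  [X^i]λ_K)` with `σ_K ≡ ι`, `τ_K ≡ θ`, `υ_K ≡ κ`, `λ_K ≡ Λ_K (mod X^{K+1})` (first three identified with CAR F's by uniqueness of the polynomial);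
  ★★ `exists_polynomial_largeForceCoeffZd_thirdCoeff_series (t s) (3 ≤ k)`: `d ↦ c_k^{(d)}` has degree EXACTLY `k − 1`, CAR F's top two
  coefficients, and `[d^{k−3}] c_k^{(d)} = [X^k](4X⁵(5+14X+52X²+40X³)ι⁵ + T_k)`; ★★★ `exists_polynomial_largeForceCoeffZd_thirdCoeff (t s) (4 ≤ k)`
  — THE RESPONSE THEOREM: `[d^{k−3}] c_k^{(d)} = (−2)^k(−3k⁴+38k³−165k²+214k+120)/96 + Σ_{3 ≤ c ≤ k} t(c)·C(k,c)·(−2)^{k−c} +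
  Σ_{4 ≤ c ≤ k} s(c)·C(k+1,c+1)·(−2)^{k−c}`; ★★★ `exists_polynomial_largeForceCoeffZd_topFour` (degree-bound form for the next order).
* PART V `Collapse` — ★★★ `exists_polynomial_largeForceCoeffZd_thirdCoeff_of_census_laws (t s) (3 ≤ k)`: IF the census fourth symbols obey the
  lane's two laws — (L1) `48·t(c) = −2^c(c³ − 12c² + 59c − 138)` for `c ≥ 5` and (L2′) `48·s(c) = −2^c(c⁴ − 12c³ + 65c² − 180c + 198)` for `c ≥ 4`
  (hypotheses; the exceptional cells `t(3) = 0`, `t(4) = 2` are PROVED from `count_three_eq` / `count_four_eq`) — THEN for every `k ≥ 3`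
  `[d^{k−3}] c_k^{(d)} = (−1)^{k−1}2^{k−3}(k−3)(k−4)(5k²−35k+56)/12`, Am. BC's registered law: the law terms telescope (`alg5_tele_p/q`:
  `ι⁴Σ_{j<k} w^{j+1}p(j+1) = B_p(w) − w^{k+1}R_p`, `ι⁵Σ_{j<k} w^{j+1}q(j+1) = B_q(w) − w^{k+1}R_q`), the four exceptional cells `j ≤ 3` and the boundary
  polynomials cancel against `−8X⁵(2 + 15X + 24X² + 20X³)ι⁵` (`alg5_close`, a 24-term certificate), so `T_k ≡ −8X⁵(2+15X+24X²+20X³)ι⁵` and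
  `G₄⁰ + T_k ≡ 4X⁵(1 − 16X + 4X²)ι⁵ (mod X^{k+1})`, whose coefficients are that law (`alg5_coeff_H`).
WHAT THIS SETTLES: the fourth `1/d`-symbol of `c_k^{(d)}` is reduced, for every `k`, to the two census fourth symbols `t`, `s` by an explicit
binomial response (PART IV, unconditional), and Am. BC's law `[d^{k−3}] c_k^{(d)} = (−1)^{k−1}2^{k−3}(k−3)(k−4)(5k²−35k+56)/12` is a THEOREM
CONDITIONAL on exactly the two census laws (L1) (`c ≥ 5`) and (L2′) (`c ≥ 4`) of the lane's FINDING-ZD-FOURTH-SYMBOL (blind-verified, NOT proved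
here — they are the next cars; nothing else is assumed). [cite: MadrasSlade1993, §1.1 eq. (1.1.8) p. 5; §4.2 eq. (4.2.20)–(4.2.22)]
[cite: ClisbyLiangSlade2007, §1.3 eq. (1)/(3)]

Provenance: lane «pcv-sawmu», a-p1 g19 (Parts I–II, III up to `alg4_coeff_G`, IV `exists_symbolQuad_coeff_A`; design `DESIGN-ZD-HIGHER-SYMBOLS.md`,
certificates `derive4.py`, `derive4b.py`, generator `gen_step4.py`) and a-p1 g20 (`alg4_E`, `alg4_coeff_T`, the response theorems, Part V with
certificates `derive5.py`), 2026-08-26/27.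
Data (not used in any proof): the values of Am. BC's law are `0, 0, 4, −104, 896, −5120` for `k = 3 … 8` (= the tree's closed forms
`largeForceCoeffZd_at_three … _at_eight`), `23360, −92288` (`k = 9, 10`; the lane's Am. AZ data of record) and `329728, −1093632` (`k = 11, 12`;
Am. BC's blind cells, reproduced on an independent code before this file was written).
-/

noncomputable section

open Finset
open scoped BigOperators

namespace Literature.Probability.RandomPlanarGeometry.SAW.Zd

/-! ### Part I — the fourth-order telescoping certificate and the closing identity -/

section Algebra4

/-- `(1 + 2X) · Σ_i (−2)^i X^i = 1` in `ℚ⟦X⟧`. [cite: MadrasSlade1993, §1.1 eq. (1.1.8) p. 5; lane plumbing] -/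
private theorem alg4_iota_mul :
    (1 + PowerSeries.C (2 : ℚ) * PowerSeries.X) * PowerSeries.mk (fun i : ℕ => (-2 : ℚ) ^ i) = 1 := by
  ext n
  rw [add_mul, one_mul, map_add, PowerSeries.coeff_mk, mul_assoc, PowerSeries.coeff_C_mul, PowerSeries.coeff_one]
  rcases n with _ | n
  · rw [PowerSeries.coeff_zero_X_mul, mul_zero, add_zero, pow_zero, if_pos rfl]
  · rw [PowerSeries.coeff_succ_X_mul, PowerSeries.coeff_mk, if_neg (Nat.succ_ne_zero n), pow_succ]
    ring

/-- `2·C(j,2) = j(j−1)` as an identity of casts. [cite: MadrasSlade1993, §1.1 eq. (1.1.8) p. 5; lane plumbing] -/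
private theorem alg4_two_mul_cast_choose_two (j : ℕ) :
    (2 : PowerSeries ℚ) * ((j.choose 2 : ℕ) : PowerSeries ℚ) = (j : PowerSeries ℚ) * ((j : PowerSeries ℚ) - 1) := by
  induction j with
  | zero => simp
  | succ j ih =>
    rw [Nat.choose_succ_succ' j 1, Nat.choose_one_right]
    push_cast
    linear_combination ih

/-- `6·C(j,3) = j(j−1)(j−2)` as an identity of casts. [cite: MadrasSlade1993, §1.1 eq. (1.1.8) p. 5; lane plumbing] -/
private theorem alg4_six_mul_cast_choose_three (j : ℕ) :
    (6 : PowerSeries ℚ) * ((j.choose 3 : ℕ) : PowerSeries ℚ) =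
      (j : PowerSeries ℚ) * ((j : PowerSeries ℚ) - 1) * ((j : PowerSeries ℚ) - 2) := by
  induction j with
  | zero => simp
  | succ j ih =>
    rw [Nat.choose_succ_succ' j 2]
    push_cast
    linear_combination ih + 3 * alg4_two_mul_cast_choose_two j

/-- ★ THE FOURTH-ORDER TELESCOPING CERTIFICATE (found by computer algebra, checked by `ring`): for `i = 1 − w`,
`Σ_{j ≤ K} w^{j+1} G⁽⁴⁾_j(w, i) = A₄(w) + w^{K+2} R₄(K, w)` where `G⁽⁴⁾_j(w, i) = −12(j+2)(j+1)w⁵i⁴(i²−wi+w²) + 2(j+2)(j+1)j w⁶i⁵ +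
12j(j+2)w³i⁴(i²−wi+w²) − 6j(j+2)(j+1)w⁴i⁵ + 6(j²−3j+4)(j+2)w²i⁵ + 2j(j−1)(j−2)(j+3)w²i⁶` is `96ι⁴` times the known part of the generic term of
the fourth-symbol recursion at `(ι, θ, κ)` (`θ = w²ι/2`, `κ = −(w³/4)(ι²−wι+w²)`), `A₄(w) = 48w³ − 204w⁴ + 384w⁵ − 384w⁶ + 348w⁷ − 288w⁸ + 96w⁹`
and `R₄` is quartic in `K`, of degree `10` in `w`. [cite: MadrasSlade1993, §1.1 eq. (1.1.8) p. 5; lane lemma] -/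
private theorem alg4_model_sum (w i : PowerSeries ℚ) (hi : i = 1 - w) (K : ℕ) :
    ∑ j ∈ Finset.range (K + 1), w ^ (j + 1) *
      (-(12 : PowerSeries ℚ) * ((j : PowerSeries ℚ) + 2) * ((j : PowerSeries ℚ) + 1) * w ^ 5 * i ^ 4 * (i ^ 2 - w * i + w ^ 2) +
        2 * ((j : PowerSeries ℚ) + 2) * ((j : PowerSeries ℚ) + 1) * (j : PowerSeries ℚ) * w ^ 6 * i ^ 5 +
        12 * (j : PowerSeries ℚ) * ((j : PowerSeries ℚ) + 2) * w ^ 3 * i ^ 4 * (i ^ 2 - w * i + w ^ 2) -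
        6 * (j : PowerSeries ℚ) * ((j : PowerSeries ℚ) + 2) * ((j : PowerSeries ℚ) + 1) * w ^ 4 * i ^ 5 +
        6 * ((j : PowerSeries ℚ) ^ 2 - 3 * (j : PowerSeries ℚ) + 4) * ((j : PowerSeries ℚ) + 2) * w ^ 2 * i ^ 5 +
        2 * (j : PowerSeries ℚ) * ((j : PowerSeries ℚ) - 1) * ((j : PowerSeries ℚ) - 2) * ((j : PowerSeries ℚ) + 3) * w ^ 2 * i ^ 6) =
    (48 * w ^ 3 - 204 * w ^ 4 + 384 * w ^ 5 - 384 * w ^ 6 + 348 * w ^ 7 - 288 * w ^ 8 + 96 * w ^ 9) +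
      w ^ (K + 2) * ((-2 * (K : PowerSeries ℚ) ^ 4 - 14 * (K : PowerSeries ℚ) ^ 3 - 10 * (K : PowerSeries ℚ) ^ 2 + 14 * (K : PowerSeries ℚ) - 36) * w ^ 2 +
        (10 * (K : PowerSeries ℚ) ^ 4 + 56 * (K : PowerSeries ℚ) ^ 3 - 28 * (K : PowerSeries ℚ) ^ 2 - 182 * (K : PowerSeries ℚ) + 96) * w ^ 3 +
        (-20 * (K : PowerSeries ℚ) ^ 4 - 78 * (K : PowerSeries ℚ) ^ 3 + 230 * (K : PowerSeries ℚ) ^ 2 + 552 * (K : PowerSeries ℚ) - 120) * w ^ 4 +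
        (20 * (K : PowerSeries ℚ) ^ 4 + 32 * (K : PowerSeries ℚ) ^ 3 - 464 * (K : PowerSeries ℚ) ^ 2 - 800 * (K : PowerSeries ℚ) + 60) * w ^ 5 +
        (-10 * (K : PowerSeries ℚ) ^ 4 + 20 * (K : PowerSeries ℚ) ^ 3 + 394 * (K : PowerSeries ℚ) ^ 2 + 448 * (K : PowerSeries ℚ) - 264) * w ^ 6 +
        (2 * (K : PowerSeries ℚ) ^ 4 - 16 * (K : PowerSeries ℚ) ^ 3 - 26 * (K : PowerSeries ℚ) ^ 2 + 424 * (K : PowerSeries ℚ) + 720) * w ^ 7 +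
        (-6 * (K : PowerSeries ℚ) ^ 3 - 228 * (K : PowerSeries ℚ) ^ 2 - 870 * (K : PowerSeries ℚ) - 744) * w ^ 8 +
        (8 * (K : PowerSeries ℚ) ^ 3 + 174 * (K : PowerSeries ℚ) ^ 2 + 526 * (K : PowerSeries ℚ) + 360) * w ^ 9 +
        (-2 * (K : PowerSeries ℚ) ^ 3 - 42 * (K : PowerSeries ℚ) ^ 2 - 112 * (K : PowerSeries ℚ) - 72) * w ^ 10) := by
  subst hi
  induction K with
  | zero => rw [Finset.sum_range_one]; push_cast; ring
  | succ K ih => rw [Finset.sum_range_succ, ih]; push_cast; ring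

/-- ★ The KNOWN part of the generic term of the fourth-symbol recursion at `(σ,τ,υ) := (ι, θ, κ)` (the parts in `λ`, `t₄`, `s₄` are linear
passengers and not included), multiplied by `96ι⁴`, is `w^{j+1} G⁽⁴⁾_j(w, ι)` (`w = 2Xι`), except on the cells `j = 0, 1` where the third census
symbol `t₃` is `0` instead of the uniform `1`, giving the corrections `384X³ι⁸`, `576X⁴ι⁹`. Pure ring identity (any `X`, `ι`).
[cite: MadrasSlade1993, §1.1 eq. (1.1.8) p. 5; lane lemma] -/
private theorem alg4_term (j : ℕ) (X ι : PowerSeries ℚ) :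
    96 * ι ^ 4 * (X ^ (j + 1) *
      ((2 : PowerSeries ℚ) ^ (j + 1) * (2 * (((j + 2).choose 2 : ℕ) : PowerSeries ℚ) * ι ^ j * (2 * X ^ 2 * ι ^ 3) *
          (-(2 * X ^ 3 * (1 - 2 * X + 4 * X ^ 2) * ι ^ 5)) + (((j + 2).choose 3 : ℕ) : PowerSeries ℚ) * ι ^ (j - 1) * (2 * X ^ 2 * ι ^ 3) ^ 3) -
        ((j : PowerSeries ℚ) * 2 ^ j) * ((((j + 2 : ℕ) : PowerSeries ℚ)) * ι ^ (j + 1) * (-(2 * X ^ 3 * (1 - 2 * X + 4 * X ^ 2) * ι ^ 5)) +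
          (((j + 2).choose 2 : ℕ) : PowerSeries ℚ) * ι ^ j * (2 * X ^ 2 * ι ^ 3) ^ 2) +
        (if 2 ≤ j then (2 : PowerSeries ℚ) ^ (j - 2) * ((j : PowerSeries ℚ) ^ 2 - 3 * (j : PowerSeries ℚ) + 4) else 0) *
          ((((j + 2 : ℕ) : PowerSeries ℚ)) * ι ^ (j + 1) * (2 * X ^ 2 * ι ^ 3)) +
        (((j.choose 3 : ℕ) : PowerSeries ℚ) * 2 ^ (j - 1)) * ((((j + 3 : ℕ) : PowerSeries ℚ)) * ι ^ (j + 2) * (2 * X ^ 2 * ι ^ 3)))) =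
    (2 * X * ι) ^ (j + 1) *
      (-(12 : PowerSeries ℚ) * ((j : PowerSeries ℚ) + 2) * ((j : PowerSeries ℚ) + 1) * (2 * X * ι) ^ 5 * ι ^ 4 *
          (ι ^ 2 - (2 * X * ι) * ι + (2 * X * ι) ^ 2) +
        2 * ((j : PowerSeries ℚ) + 2) * ((j : PowerSeries ℚ) + 1) * (j : PowerSeries ℚ) * (2 * X * ι) ^ 6 * ι ^ 5 +
        12 * (j : PowerSeries ℚ) * ((j : PowerSeries ℚ) + 2) * (2 * X * ι) ^ 3 * ι ^ 4 * (ι ^ 2 - (2 * X * ι) * ι + (2 * X * ι) ^ 2) -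
        6 * (j : PowerSeries ℚ) * ((j : PowerSeries ℚ) + 2) * ((j : PowerSeries ℚ) + 1) * (2 * X * ι) ^ 4 * ι ^ 5 +
        6 * ((j : PowerSeries ℚ) ^ 2 - 3 * (j : PowerSeries ℚ) + 4) * ((j : PowerSeries ℚ) + 2) * (2 * X * ι) ^ 2 * ι ^ 5 +
        2 * (j : PowerSeries ℚ) * ((j : PowerSeries ℚ) - 1) * ((j : PowerSeries ℚ) - 2) * ((j : PowerSeries ℚ) + 3) * (2 * X * ι) ^ 2 * ι ^ 6) -
    (if j = 0 then 384 * X ^ 3 * ι ^ 8 else if j = 1 then 576 * X ^ 4 * ι ^ 9 else 0) := by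
  rcases j with _ | _ | m
  · simp only [show ¬ (2 ≤ 0) by omega, if_false, if_true, Nat.choose_zero_succ, Nat.choose_self,
      show Nat.choose 2 3 = 0 by decide]
    push_cast
    ring
  · simp only [show ¬ (2 ≤ 1) by omega, show (1 : ℕ) ≠ 0 by omega, if_false, if_true,
      show Nat.choose 1 3 = 0 by decide, show Nat.choose 3 2 = 3 by decide, show Nat.choose 3 3 = 1 by decide]
    push_cast
    ring
  · rw [if_pos (by omega : 2 ≤ m + 2), if_neg (by omega : m + 2 ≠ 0), if_neg (by omega : m + 2 ≠ 1), show m + 2 - 2 = m by omega,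
      show m + 2 - 1 = m + 1 by omega]
    have e2 := alg4_two_mul_cast_choose_two (m + 2 + 2)
    have e3 := alg4_six_mul_cast_choose_three (m + 2 + 2)
    have f3 := alg4_six_mul_cast_choose_three (m + 2)
    push_cast at e2 e3 f3 ⊢
    linear_combination (-12288 * ι ^ m * (2 : PowerSeries ℚ) ^ m * X ^ 10 * X ^ m * ι ^ 14 + 6144 * ι ^ m * (2 : PowerSeries ℚ) ^ m * X ^ 9 * X ^ m * ι ^ 14 -
        3072 * ι ^ m * (2 : PowerSeries ℚ) ^ m * X ^ 8 * X ^ m * ι ^ 14 - 768 * ι ^ m * (m : PowerSeries ℚ) * (2 : PowerSeries ℚ) ^ m * X ^ 7 * X ^ m * ι ^ 12 -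
        1536 * ι ^ m * (2 : PowerSeries ℚ) ^ m * X ^ 7 * X ^ m * ι ^ 12) * e2 +
      (1024 * ι ^ m * (2 : PowerSeries ℚ) ^ m * X ^ 9 * X ^ m * ι ^ 14) * e3 +
      (64 * ι ^ m * (m : PowerSeries ℚ) * (2 : PowerSeries ℚ) ^ m * X ^ 5 * X ^ m * ι ^ 11 + 320 * ι ^ m * (2 : PowerSeries ℚ) ^ m * X ^ 5 * X ^ m * ι ^ 11) * f3

/-- ★ The CLOSING IDENTITY of the fourth-order fixed point (known part): with `λ₀ = −4X⁵(7 + 12X + 60X² + 40X³)ι⁷`, `w = 2Xι`,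
`θ = 2X²ι³`: `96ι²λ₀ + A₄(w) − 96ι⁴(wθ + ¾w²θ) = 0` in `ℚ⟦X⟧` (uses `(1+2X)ι = 1`; certificate by computer algebra).
[cite: MadrasSlade1993, §1.1 eq. (1.1.8) p. 5; lane lemma] -/
private theorem alg4_close (X ι : PowerSeries ℚ) (hF1 : (1 + 2 * X) * ι = 1) :
    96 * ι ^ 2 * (-(4 * X ^ 5 * (7 + 12 * X + 60 * X ^ 2 + 40 * X ^ 3) * ι ^ 7)) +
      (48 * (2 * X * ι) ^ 3 - 204 * (2 * X * ι) ^ 4 + 384 * (2 * X * ι) ^ 5 - 384 * (2 * X * ι) ^ 6 + 348 * (2 * X * ι) ^ 7 -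
        288 * (2 * X * ι) ^ 8 + 96 * (2 * X * ι) ^ 9) -
      (96 * ι ^ 4 * ((2 * X * ι) * (2 * X ^ 2 * ι ^ 3)) + 72 * ι ^ 4 * ((2 * X * ι) ^ 2 * (2 * X ^ 2 * ι ^ 3))) = 0 := by
  linear_combination (24576 * X ^ 8 * ι ^ 8 - 19968 * X ^ 7 * ι ^ 8 - 1536 * X ^ 6 * ι ^ 8 - 24576 * X ^ 7 * ι ^ 7 - 1536 * X ^ 5 * ι ^ 8 + 2304 * X ^ 6 * ι ^ 7 - 576 * X ^ 4 * ι ^ 8 - 1920 * X ^ 5 * ι ^ 7 + 9984 * X ^ 6 * ι ^ 6 + 192 * X ^ 4 * ι ^ 7 - 3840 * X ^ 5 * ι ^ 6 - 384 * X ^ 3 * ι ^ 7 + 960 * X ^ 4 * ι ^ 6 - 7296 * X ^ 5 * ι ^ 5 - 384 * X ^ 3 * ι ^ 6 + 1728 * X ^ 4 * ι ^ 5 - 384 * X ^ 3 * ι ^ 5 + 2496 * X ^ 4 * ι ^ 4 - 384 * X ^ 3 * ι ^ 4 - 384 * X ^ 3 * ι ^ 3) * hF1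

end Algebra4


/-! ### Part II — the fourth-order fixed point survives one recursion step -/

section Step4

/-- In `ℚ⟦X⟧`, `X^n ∣ q·ι^a·f` implies `X^n ∣ f` (`q ≠ 0` and `ι = (1+2X)⁻¹` are units). [cite: MadrasSlade1993, §1.1 eq. (1.1.8) p. 5; lane plumbing] -/
private theorem alg4_dvd_of_dvd_unit_mul {n : ℕ} {f : PowerSeries ℚ} (a : ℕ) (q : ℚ) (hq : q ≠ 0)
    (h : (PowerSeries.X : PowerSeries ℚ) ^ n ∣ PowerSeries.C q * PowerSeries.mk (fun i : ℕ => (-2 : ℚ) ^ i) ^ a * f) :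
    (PowerSeries.X : PowerSeries ℚ) ^ n ∣ f := by
  have hF1 := alg4_iota_mul
  have key : (PowerSeries.C q⁻¹ * (1 + PowerSeries.C (2 : ℚ) * PowerSeries.X) ^ a) *
      (PowerSeries.C q * PowerSeries.mk (fun i : ℕ => (-2 : ℚ) ^ i) ^ a * f) = f := by
    have hrw : (PowerSeries.C q⁻¹ * (1 + PowerSeries.C (2 : ℚ) * PowerSeries.X) ^ a) *
        (PowerSeries.C q * PowerSeries.mk (fun i : ℕ => (-2 : ℚ) ^ i) ^ a * f) =
        (PowerSeries.C q⁻¹ * PowerSeries.C q) *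
          ((1 + PowerSeries.C (2 : ℚ) * PowerSeries.X) * PowerSeries.mk (fun i : ℕ => (-2 : ℚ) ^ i)) ^ a * f := by
      rw [mul_pow]; ring
    rw [hrw, ← map_mul, inv_mul_cancel₀ hq, map_one, hF1, one_pow, one_mul, one_mul]
  rw [← key]
  exact dvd_mul_of_dvd_right h _

/-- `ι² Σ_{j ≤ K} (j+2) w^{j+1} = 1 − ι² − (K+3)w^{K+2} + (K+2)w^{K+3}` for `ι = 1 − w`. [cite: MadrasSlade1993, §1.1 eq. (1.1.8) p. 5; lane plumbing] -/
private theorem alg4_geom_lin (w i : PowerSeries ℚ) (hi : i = 1 - w) (K : ℕ) :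
    i ^ 2 * ∑ j ∈ Finset.range (K + 1), ((j : PowerSeries ℚ) + 2) * w ^ (j + 1) =
      1 - i ^ 2 - ((K : PowerSeries ℚ) + 3) * w ^ (K + 2) + ((K : PowerSeries ℚ) + 2) * w ^ (K + 3) := by
  subst hi
  induction K with
  | zero => rw [Finset.sum_range_one]; push_cast; ring
  | succ K ih => rw [Finset.sum_range_succ, mul_add, ih]; push_cast; ring

set_option maxHeartbeats 400000 in
/-- ★★ THE FOURTH-SYMBOL RECURSION PRESERVES `λ₀ − ι²·T`: if `σ ≡ ι`, `τ ≡ θ`, `υ ≡ κ` and `λ ≡ Λ_K := λ₀ − ι² T_K (mod X^{K+1})`, where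
`λ₀ = −4X⁵(7+12X+60X²+40X³)ι⁷` and `T_K = Σ_{c ≤ K} X^c (t₄(c) ι^{c+1} + s₄(c) ι^{c+2})` carries the census fourth symbols, then the fourth
symbol polynomial of `A_{K+1}` produced by `symbolQuad_A_succ` is `≡ Λ_{K+1} (mod X^{K+2})`. Proof: `96ι⁶ ×` (recursion at (ι, θ, κ, Λ_K)) = the
telescoping sum of `alg4_model_sum` + the linear part closed by `alg4_geom_lin` + the passengers, and the boundary polynomial is `−96ι²λ₀` up to
the two exceptional cells (`alg4_close`). [cite: MadrasSlade1993, §1.1 eq. (1.1.8) p. 5; lane lemma] -/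
private theorem alg4_A_step_fourth (t s : ℕ → ℚ) {K : ℕ} {σ τ υ μ : Polynomial ℚ}
    (hσ : (PowerSeries.X : PowerSeries ℚ) ^ (K + 1) ∣ ((σ : PowerSeries ℚ) - PowerSeries.mk (fun i : ℕ => (-2 : ℚ) ^ i)))
    (hτ : (PowerSeries.X : PowerSeries ℚ) ^ (K + 1) ∣ ((τ : PowerSeries ℚ) -
      PowerSeries.C (2 : ℚ) * PowerSeries.X ^ 2 * PowerSeries.mk (fun i : ℕ => (-2 : ℚ) ^ i) ^ 3))
    (hυ : (PowerSeries.X : PowerSeries ℚ) ^ (K + 1) ∣ ((υ : PowerSeries ℚ) -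
      -(PowerSeries.C (2 : ℚ) * PowerSeries.X ^ 3 * (1 - PowerSeries.C (2 : ℚ) * PowerSeries.X + PowerSeries.C (4 : ℚ) * PowerSeries.X ^ 2) *
        PowerSeries.mk (fun i : ℕ => (-2 : ℚ) ^ i) ^ 5)))
    (hμ : (PowerSeries.X : PowerSeries ℚ) ^ (K + 1) ∣ ((μ : PowerSeries ℚ) -
      ((-(4 * PowerSeries.X ^ 5 * (7 + 12 * PowerSeries.X + 60 * PowerSeries.X ^ 2 + 40 * PowerSeries.X ^ 3) * PowerSeries.mk (fun i : ℕ => (-2 : ℚ) ^ i) ^ 7)) - PowerSeries.mk (fun i : ℕ => (-2 : ℚ) ^ i) ^ 2 *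
        (∑ j ∈ Finset.range K, PowerSeries.X ^ (j + 1) * ((if 2 ≤ j then PowerSeries.C (t (j + 1)) else 0) * PowerSeries.mk (fun i : ℕ => (-2 : ℚ) ^ i) ^ (j + 2) +
        (if 3 ≤ j then PowerSeries.C (s (j + 1)) else 0) * PowerSeries.mk (fun i : ℕ => (-2 : ℚ) ^ i) ^ (j + 3)))))) :
    (PowerSeries.X : PowerSeries ℚ) ^ (K + 2) ∣
      ((((0 - ∑ j ∈ Finset.range (K + 1), Polynomial.X ^ (j + 1) *
        (Polynomial.C ((2 : ℚ) ^ (j + 1)) * (((j + 2 : ℕ) : Polynomial ℚ) * σ ^ (j + 1) * μ +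
            2 * (((j + 2).choose 2 : ℕ) : Polynomial ℚ) * σ ^ j * τ * υ + (((j + 2).choose 3 : ℕ) : Polynomial ℚ) * σ ^ (j - 1) * τ ^ 3) -
          Polynomial.C ((j : ℚ) * 2 ^ j) * (((j + 2 : ℕ) : Polynomial ℚ) * σ ^ (j + 1) * υ +
            (((j + 2).choose 2 : ℕ) : Polynomial ℚ) * σ ^ j * τ ^ 2) +
          Polynomial.C (if 2 ≤ j then (2 : ℚ) ^ (j - 2) * ((j : ℚ) ^ 2 - 3 * j + 4) else 0) * (((j + 2 : ℕ) : Polynomial ℚ) * σ ^ (j + 1) * τ) +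
          Polynomial.C (if 2 ≤ j then t (j + 1) else 0) * σ ^ (j + 2) +
          Polynomial.C (((j.choose 3 : ℕ) : ℚ) * 2 ^ (j - 1)) * (((j + 3 : ℕ) : Polynomial ℚ) * σ ^ (j + 2) * τ) +
          Polynomial.C (if 3 ≤ j then s (j + 1) else 0) * σ ^ (j + 3)) : Polynomial ℚ)) : PowerSeries ℚ) -
        ((-(4 * PowerSeries.X ^ 5 * (7 + 12 * PowerSeries.X + 60 * PowerSeries.X ^ 2 + 40 * PowerSeries.X ^ 3) * PowerSeries.mk (fun i : ℕ => (-2 : ℚ) ^ i) ^ 7)) - PowerSeries.mk (fun i : ℕ => (-2 : ℚ) ^ i) ^ 2 *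
        (∑ j ∈ Finset.range (K + 1), PowerSeries.X ^ (j + 1) * ((if 2 ≤ j then PowerSeries.C (t (j + 1)) else 0) * PowerSeries.mk (fun i : ℕ => (-2 : ℚ) ^ i) ^ (j + 2) +
        (if 3 ≤ j then PowerSeries.C (s (j + 1)) else 0) * PowerSeries.mk (fun i : ℕ => (-2 : ℚ) ^ i) ^ (j + 3))))) := by
  set ι : PowerSeries ℚ := PowerSeries.mk (fun i : ℕ => (-2 : ℚ) ^ i) with hι
  have hF1' : (1 + PowerSeries.C (2 : ℚ) * PowerSeries.X) * ι = 1 := alg4_iota_mul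
  have hC2 : PowerSeries.C (2 : ℚ) = 2 := map_ofNat _ 2
  have hC3 : PowerSeries.C (3 : ℚ) = 3 := map_ofNat _ 3
  have hC4 : PowerSeries.C (4 : ℚ) = 4 := map_ofNat _ 4
  have hF1 : (1 + 2 * PowerSeries.X) * ι = 1 := by rw [← hC2]; exact hF1'
  rw [hC2] at hτ
  rw [hC2, hC4] at hυ
  -- (1) cast of the polynomial
  have hQ : (((0 - ∑ j ∈ Finset.range (K + 1), Polynomial.X ^ (j + 1) *
        (Polynomial.C ((2 : ℚ) ^ (j + 1)) * (((j + 2 : ℕ) : Polynomial ℚ) * σ ^ (j + 1) * μ +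
            2 * (((j + 2).choose 2 : ℕ) : Polynomial ℚ) * σ ^ j * τ * υ + (((j + 2).choose 3 : ℕ) : Polynomial ℚ) * σ ^ (j - 1) * τ ^ 3) -
          Polynomial.C ((j : ℚ) * 2 ^ j) * (((j + 2 : ℕ) : Polynomial ℚ) * σ ^ (j + 1) * υ +
            (((j + 2).choose 2 : ℕ) : Polynomial ℚ) * σ ^ j * τ ^ 2) +
          Polynomial.C (if 2 ≤ j then (2 : ℚ) ^ (j - 2) * ((j : ℚ) ^ 2 - 3 * j + 4) else 0) * (((j + 2 : ℕ) : Polynomial ℚ) * σ ^ (j + 1) * τ) +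
          Polynomial.C (if 2 ≤ j then t (j + 1) else 0) * σ ^ (j + 2) +
          Polynomial.C (((j.choose 3 : ℕ) : ℚ) * 2 ^ (j - 1)) * (((j + 3 : ℕ) : Polynomial ℚ) * σ ^ (j + 2) * τ) +
          Polynomial.C (if 3 ≤ j then s (j + 1) else 0) * σ ^ (j + 3)) : Polynomial ℚ)) : PowerSeries ℚ) =
      0 - ∑ j ∈ Finset.range (K + 1), PowerSeries.X ^ (j + 1) *
        ((2 : PowerSeries ℚ) ^ (j + 1) * ((((j + 2 : ℕ) : PowerSeries ℚ)) * (σ : PowerSeries ℚ) ^ (j + 1) * (μ : PowerSeries ℚ) +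
            2 * (((j + 2).choose 2 : ℕ) : PowerSeries ℚ) * (σ : PowerSeries ℚ) ^ j * (τ : PowerSeries ℚ) * (υ : PowerSeries ℚ) + (((j + 2).choose 3 : ℕ) : PowerSeries ℚ) * (σ : PowerSeries ℚ) ^ (j - 1) * (τ : PowerSeries ℚ) ^ 3) -
          ((j : PowerSeries ℚ) * 2 ^ j) * ((((j + 2 : ℕ) : PowerSeries ℚ)) * (σ : PowerSeries ℚ) ^ (j + 1) * (υ : PowerSeries ℚ) +
            (((j + 2).choose 2 : ℕ) : PowerSeries ℚ) * (σ : PowerSeries ℚ) ^ j * (τ : PowerSeries ℚ) ^ 2) +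
          (if 2 ≤ j then (2 : PowerSeries ℚ) ^ (j - 2) * ((j : PowerSeries ℚ) ^ 2 - 3 * (j : PowerSeries ℚ) + 4) else 0) * ((((j + 2 : ℕ) : PowerSeries ℚ)) * (σ : PowerSeries ℚ) ^ (j + 1) * (τ : PowerSeries ℚ)) +
          (if 2 ≤ j then PowerSeries.C (t (j + 1)) else 0) * (σ : PowerSeries ℚ) ^ (j + 2) +
          (((j.choose 3 : ℕ) : PowerSeries ℚ) * 2 ^ (j - 1)) * ((((j + 3 : ℕ) : PowerSeries ℚ)) * (σ : PowerSeries ℚ) ^ (j + 2) * (τ : PowerSeries ℚ)) +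
          (if 3 ≤ j then PowerSeries.C (s (j + 1)) else 0) * (σ : PowerSeries ℚ) ^ (j + 3)) := by
    rw [← Polynomial.coeToPowerSeries.ringHom_apply, map_sub, map_zero, map_sum]
    refine congrArg _ (Finset.sum_congr rfl fun j _ => ?_)
    simp only [map_mul, map_pow, map_add, map_sub, map_natCast, map_zero, Polynomial.coeToPowerSeries.ringHom_apply,
      Polynomial.coe_C, Polynomial.coe_X, apply_ite PowerSeries.C, hC2, hC3, hC4, map_ofNat]
  rw [hQ]
  set X : PowerSeries ℚ := PowerSeries.X with hX
  set θ : PowerSeries ℚ := 2 * X ^ 2 * ι ^ 3 with hθ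
  set κ : PowerSeries ℚ := -(2 * X ^ 3 * (1 - 2 * X + 4 * X ^ 2) * ι ^ 5) with hκ
  set Λ0 : PowerSeries ℚ := -(4 * X ^ 5 * (7 + 12 * X + 60 * X ^ 2 + 40 * X ^ 3) * ι ^ 7) with hΛ0
  have hT : (∑ j ∈ Finset.range (K + 1), X ^ (j + 1) * ((if 2 ≤ j then PowerSeries.C (t (j + 1)) else 0) * ι ^ (j + 2) +
        (if 3 ≤ j then PowerSeries.C (s (j + 1)) else 0) * ι ^ (j + 3))) =
      (∑ j ∈ Finset.range K, X ^ (j + 1) * ((if 2 ≤ j then PowerSeries.C (t (j + 1)) else 0) * ι ^ (j + 2) +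
        (if 3 ≤ j then PowerSeries.C (s (j + 1)) else 0) * ι ^ (j + 3))) +
      X ^ (K + 1) * ((if 2 ≤ K then PowerSeries.C (t (K + 1)) else 0) * ι ^ (K + 2) +
        (if 3 ≤ K then PowerSeries.C (s (K + 1)) else 0) * ι ^ (K + 3)) := by
    rw [Finset.sum_range_succ]
  set T0 : PowerSeries ℚ := (∑ j ∈ Finset.range K, X ^ (j + 1) * ((if 2 ≤ j then PowerSeries.C (t (j + 1)) else 0) * ι ^ (j + 2) +
        (if 3 ≤ j then PowerSeries.C (s (j + 1)) else 0) * ι ^ (j + 3))) with hT0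
  set Λ : PowerSeries ℚ := Λ0 - ι ^ 2 * T0 with hΛ
  have hwX : X ∣ 2 * X * ι := Dvd.intro_left 2 (by ring) |>.mul_right ι
  -- (2) congruences of the inputs' monomials
  have hσpow : ∀ m : ℕ, X ^ (K + 1) ∣ (σ : PowerSeries ℚ) ^ m - ι ^ m := fun m => hσ.trans (sub_dvd_pow_sub_pow _ _ m)
  have hστ : ∀ m : ℕ, X ^ (K + 1) ∣ (σ : PowerSeries ℚ) ^ m * (τ : PowerSeries ℚ) - ι ^ m * θ := by
    intro m
    have : (σ : PowerSeries ℚ) ^ m * (τ : PowerSeries ℚ) - ι ^ m * θ =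
        (σ : PowerSeries ℚ) ^ m * ((τ : PowerSeries ℚ) - θ) + ((σ : PowerSeries ℚ) ^ m - ι ^ m) * θ := by ring
    rw [this]
    exact dvd_add (dvd_mul_of_dvd_right hτ _) (dvd_mul_of_dvd_left (hσpow m) _)
  have hσττ : ∀ m : ℕ, X ^ (K + 1) ∣ (σ : PowerSeries ℚ) ^ m * (τ : PowerSeries ℚ) ^ 2 - ι ^ m * θ ^ 2 := by
    intro m
    have : (σ : PowerSeries ℚ) ^ m * (τ : PowerSeries ℚ) ^ 2 - ι ^ m * θ ^ 2 =
        (σ : PowerSeries ℚ) ^ m * ((τ : PowerSeries ℚ) + θ) * ((τ : PowerSeries ℚ) - θ) + ((σ : PowerSeries ℚ) ^ m - ι ^ m) * θ ^ 2 := by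
      ring
    rw [this]
    exact dvd_add (dvd_mul_of_dvd_right hτ _) (dvd_mul_of_dvd_left (hσpow m) _)
  have hσ3τ : ∀ m : ℕ, X ^ (K + 1) ∣ (σ : PowerSeries ℚ) ^ m * (τ : PowerSeries ℚ) ^ 3 - ι ^ m * θ ^ 3 := by
    intro m
    have : (σ : PowerSeries ℚ) ^ m * (τ : PowerSeries ℚ) ^ 3 - ι ^ m * θ ^ 3 =
        (σ : PowerSeries ℚ) ^ m * ((τ : PowerSeries ℚ) ^ 2 + (τ : PowerSeries ℚ) * θ + θ ^ 2) * ((τ : PowerSeries ℚ) - θ) +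
          ((σ : PowerSeries ℚ) ^ m - ι ^ m) * θ ^ 3 := by ring
    rw [this]
    exact dvd_add (dvd_mul_of_dvd_right hτ _) (dvd_mul_of_dvd_left (hσpow m) _)
  have hσυ : ∀ m : ℕ, X ^ (K + 1) ∣ (σ : PowerSeries ℚ) ^ m * (υ : PowerSeries ℚ) - ι ^ m * κ := by
    intro m
    have : (σ : PowerSeries ℚ) ^ m * (υ : PowerSeries ℚ) - ι ^ m * κ =
        (σ : PowerSeries ℚ) ^ m * ((υ : PowerSeries ℚ) - κ) + ((σ : PowerSeries ℚ) ^ m - ι ^ m) * κ := by ring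
    rw [this]
    exact dvd_add (dvd_mul_of_dvd_right hυ _) (dvd_mul_of_dvd_left (hσpow m) _)
  have hστυ : ∀ m : ℕ, X ^ (K + 1) ∣ (σ : PowerSeries ℚ) ^ m * (τ : PowerSeries ℚ) * (υ : PowerSeries ℚ) - ι ^ m * θ * κ := by
    intro m
    have : (σ : PowerSeries ℚ) ^ m * (τ : PowerSeries ℚ) * (υ : PowerSeries ℚ) - ι ^ m * θ * κ =
        ((σ : PowerSeries ℚ) ^ m * (τ : PowerSeries ℚ) - ι ^ m * θ) * (υ : PowerSeries ℚ) + ι ^ m * θ * ((υ : PowerSeries ℚ) - κ) := by ring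
    rw [this]
    exact dvd_add (dvd_mul_of_dvd_left (hστ m) _) (dvd_mul_of_dvd_right hυ _)
  have hσμ : ∀ m : ℕ, X ^ (K + 1) ∣ (σ : PowerSeries ℚ) ^ m * (μ : PowerSeries ℚ) - ι ^ m * Λ := by
    intro m
    have : (σ : PowerSeries ℚ) ^ m * (μ : PowerSeries ℚ) - ι ^ m * Λ =
        (σ : PowerSeries ℚ) ^ m * ((μ : PowerSeries ℚ) - Λ) + ((σ : PowerSeries ℚ) ^ m - ι ^ m) * Λ := by ring
    rw [this]
    exact dvd_add (dvd_mul_of_dvd_right hμ _) (dvd_mul_of_dvd_left (hσpow m) _)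
  have hshift : ∀ j : ℕ, ∀ g : PowerSeries ℚ, X ^ (K + 1) ∣ g → X ^ (K + 2) ∣ X ^ (j + 1) * g := by
    intro j g hg
    rw [show K + 2 = 1 + (K + 1) by ring, pow_add, pow_one]
    exact mul_dvd_mul (dvd_pow_self _ (Nat.succ_ne_zero j)) hg
  -- (3) the model and its distance to the actual sum
  set M : PowerSeries ℚ := 0 - ∑ j ∈ Finset.range (K + 1), X ^ (j + 1) *
        ((2 : PowerSeries ℚ) ^ (j + 1) * ((((j + 2 : ℕ) : PowerSeries ℚ)) * ι ^ (j + 1) * Λ +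
            2 * (((j + 2).choose 2 : ℕ) : PowerSeries ℚ) * ι ^ j * θ * κ + (((j + 2).choose 3 : ℕ) : PowerSeries ℚ) * ι ^ (j - 1) * θ ^ 3) -
          ((j : PowerSeries ℚ) * 2 ^ j) * ((((j + 2 : ℕ) : PowerSeries ℚ)) * ι ^ (j + 1) * κ +
            (((j + 2).choose 2 : ℕ) : PowerSeries ℚ) * ι ^ j * θ ^ 2) +
          (if 2 ≤ j then (2 : PowerSeries ℚ) ^ (j - 2) * ((j : PowerSeries ℚ) ^ 2 - 3 * (j : PowerSeries ℚ) + 4) else 0) * ((((j + 2 : ℕ) : PowerSeries ℚ)) * ι ^ (j + 1) * θ) +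
          (if 2 ≤ j then PowerSeries.C (t (j + 1)) else 0) * ι ^ (j + 2) +
          (((j.choose 3 : ℕ) : PowerSeries ℚ) * 2 ^ (j - 1)) * ((((j + 3 : ℕ) : PowerSeries ℚ)) * ι ^ (j + 2) * θ) +
          (if 3 ≤ j then PowerSeries.C (s (j + 1)) else 0) * ι ^ (j + 3)) with hM
  have hdiff : X ^ (K + 2) ∣ (0 - ∑ j ∈ Finset.range (K + 1), X ^ (j + 1) *
        ((2 : PowerSeries ℚ) ^ (j + 1) * ((((j + 2 : ℕ) : PowerSeries ℚ)) * (σ : PowerSeries ℚ) ^ (j + 1) * (μ : PowerSeries ℚ) +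
            2 * (((j + 2).choose 2 : ℕ) : PowerSeries ℚ) * (σ : PowerSeries ℚ) ^ j * (τ : PowerSeries ℚ) * (υ : PowerSeries ℚ) + (((j + 2).choose 3 : ℕ) : PowerSeries ℚ) * (σ : PowerSeries ℚ) ^ (j - 1) * (τ : PowerSeries ℚ) ^ 3) -
          ((j : PowerSeries ℚ) * 2 ^ j) * ((((j + 2 : ℕ) : PowerSeries ℚ)) * (σ : PowerSeries ℚ) ^ (j + 1) * (υ : PowerSeries ℚ) +
            (((j + 2).choose 2 : ℕ) : PowerSeries ℚ) * (σ : PowerSeries ℚ) ^ j * (τ : PowerSeries ℚ) ^ 2) +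
          (if 2 ≤ j then (2 : PowerSeries ℚ) ^ (j - 2) * ((j : PowerSeries ℚ) ^ 2 - 3 * (j : PowerSeries ℚ) + 4) else 0) * ((((j + 2 : ℕ) : PowerSeries ℚ)) * (σ : PowerSeries ℚ) ^ (j + 1) * (τ : PowerSeries ℚ)) +
          (if 2 ≤ j then PowerSeries.C (t (j + 1)) else 0) * (σ : PowerSeries ℚ) ^ (j + 2) +
          (((j.choose 3 : ℕ) : PowerSeries ℚ) * 2 ^ (j - 1)) * ((((j + 3 : ℕ) : PowerSeries ℚ)) * (σ : PowerSeries ℚ) ^ (j + 2) * (τ : PowerSeries ℚ)) +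
          (if 3 ≤ j then PowerSeries.C (s (j + 1)) else 0) * (σ : PowerSeries ℚ) ^ (j + 3))) - M := by
    rw [hM, show ∀ a b : PowerSeries ℚ, (0 - a) - (0 - b) = -(a - b) from fun a b => by ring, ← Finset.sum_sub_distrib, dvd_neg]
    refine Finset.dvd_sum fun j _ => ?_
    have hsplit : X ^ (j + 1) *
        ((2 : PowerSeries ℚ) ^ (j + 1) * ((((j + 2 : ℕ) : PowerSeries ℚ)) * (σ : PowerSeries ℚ) ^ (j + 1) * (μ : PowerSeries ℚ) +
            2 * (((j + 2).choose 2 : ℕ) : PowerSeries ℚ) * (σ : PowerSeries ℚ) ^ j * (τ : PowerSeries ℚ) * (υ : PowerSeries ℚ) + (((j + 2).choose 3 : ℕ) : PowerSeries ℚ) * (σ : PowerSeries ℚ) ^ (j - 1) * (τ : PowerSeries ℚ) ^ 3) -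
          ((j : PowerSeries ℚ) * 2 ^ j) * ((((j + 2 : ℕ) : PowerSeries ℚ)) * (σ : PowerSeries ℚ) ^ (j + 1) * (υ : PowerSeries ℚ) +
            (((j + 2).choose 2 : ℕ) : PowerSeries ℚ) * (σ : PowerSeries ℚ) ^ j * (τ : PowerSeries ℚ) ^ 2) +
          (if 2 ≤ j then (2 : PowerSeries ℚ) ^ (j - 2) * ((j : PowerSeries ℚ) ^ 2 - 3 * (j : PowerSeries ℚ) + 4) else 0) * ((((j + 2 : ℕ) : PowerSeries ℚ)) * (σ : PowerSeries ℚ) ^ (j + 1) * (τ : PowerSeries ℚ)) +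
          (if 2 ≤ j then PowerSeries.C (t (j + 1)) else 0) * (σ : PowerSeries ℚ) ^ (j + 2) +
          (((j.choose 3 : ℕ) : PowerSeries ℚ) * 2 ^ (j - 1)) * ((((j + 3 : ℕ) : PowerSeries ℚ)) * (σ : PowerSeries ℚ) ^ (j + 2) * (τ : PowerSeries ℚ)) +
          (if 3 ≤ j then PowerSeries.C (s (j + 1)) else 0) * (σ : PowerSeries ℚ) ^ (j + 3)) -
        X ^ (j + 1) *
        ((2 : PowerSeries ℚ) ^ (j + 1) * ((((j + 2 : ℕ) : PowerSeries ℚ)) * ι ^ (j + 1) * Λ +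
            2 * (((j + 2).choose 2 : ℕ) : PowerSeries ℚ) * ι ^ j * θ * κ + (((j + 2).choose 3 : ℕ) : PowerSeries ℚ) * ι ^ (j - 1) * θ ^ 3) -
          ((j : PowerSeries ℚ) * 2 ^ j) * ((((j + 2 : ℕ) : PowerSeries ℚ)) * ι ^ (j + 1) * κ +
            (((j + 2).choose 2 : ℕ) : PowerSeries ℚ) * ι ^ j * θ ^ 2) +
          (if 2 ≤ j then (2 : PowerSeries ℚ) ^ (j - 2) * ((j : PowerSeries ℚ) ^ 2 - 3 * (j : PowerSeries ℚ) + 4) else 0) * ((((j + 2 : ℕ) : PowerSeries ℚ)) * ι ^ (j + 1) * θ) +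
          (if 2 ≤ j then PowerSeries.C (t (j + 1)) else 0) * ι ^ (j + 2) +
          (((j.choose 3 : ℕ) : PowerSeries ℚ) * 2 ^ (j - 1)) * ((((j + 3 : ℕ) : PowerSeries ℚ)) * ι ^ (j + 2) * θ) +
          (if 3 ≤ j then PowerSeries.C (s (j + 1)) else 0) * ι ^ (j + 3)) =
        X ^ (j + 1) *
        ((2 : PowerSeries ℚ) ^ (j + 1) * ((((j + 2 : ℕ) : PowerSeries ℚ)) * ((σ : PowerSeries ℚ) ^ (j + 1) * (μ : PowerSeries ℚ) - ι ^ (j + 1) * Λ) +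
            2 * (((j + 2).choose 2 : ℕ) : PowerSeries ℚ) * ((σ : PowerSeries ℚ) ^ j * (τ : PowerSeries ℚ) * (υ : PowerSeries ℚ) - ι ^ j * θ * κ) +
            (((j + 2).choose 3 : ℕ) : PowerSeries ℚ) * ((σ : PowerSeries ℚ) ^ (j - 1) * (τ : PowerSeries ℚ) ^ 3 - ι ^ (j - 1) * θ ^ 3)) -
          ((j : PowerSeries ℚ) * 2 ^ j) * ((((j + 2 : ℕ) : PowerSeries ℚ)) * ((σ : PowerSeries ℚ) ^ (j + 1) * (υ : PowerSeries ℚ) - ι ^ (j + 1) * κ) +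
            (((j + 2).choose 2 : ℕ) : PowerSeries ℚ) * ((σ : PowerSeries ℚ) ^ j * (τ : PowerSeries ℚ) ^ 2 - ι ^ j * θ ^ 2)) +
          (if 2 ≤ j then (2 : PowerSeries ℚ) ^ (j - 2) * ((j : PowerSeries ℚ) ^ 2 - 3 * (j : PowerSeries ℚ) + 4) else 0) *
            ((((j + 2 : ℕ) : PowerSeries ℚ)) * ((σ : PowerSeries ℚ) ^ (j + 1) * (τ : PowerSeries ℚ) - ι ^ (j + 1) * θ)) +
          (if 2 ≤ j then PowerSeries.C (t (j + 1)) else 0) * ((σ : PowerSeries ℚ) ^ (j + 2) - ι ^ (j + 2)) +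
          (((j.choose 3 : ℕ) : PowerSeries ℚ) * 2 ^ (j - 1)) * ((((j + 3 : ℕ) : PowerSeries ℚ)) * ((σ : PowerSeries ℚ) ^ (j + 2) * (τ : PowerSeries ℚ) - ι ^ (j + 2) * θ)) +
          (if 3 ≤ j then PowerSeries.C (s (j + 1)) else 0) * ((σ : PowerSeries ℚ) ^ (j + 3) - ι ^ (j + 3))) := by ring
    rw [hsplit]
    refine hshift j _ ?_
    have hA := dvd_mul_of_dvd_right (dvd_add (dvd_add (dvd_mul_of_dvd_right (hσμ (j + 1)) (((j + 2 : ℕ) : PowerSeries ℚ)))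
      (dvd_mul_of_dvd_right (hστυ j) (2 * (((j + 2).choose 2 : ℕ) : PowerSeries ℚ))))
      (dvd_mul_of_dvd_right (hσ3τ (j - 1)) ((((j + 2).choose 3 : ℕ) : PowerSeries ℚ)))) ((2 : PowerSeries ℚ) ^ (j + 1))
    have hB := dvd_mul_of_dvd_right (dvd_add (dvd_mul_of_dvd_right (hσυ (j + 1)) (((j + 2 : ℕ) : PowerSeries ℚ)))
      (dvd_mul_of_dvd_right (hσττ j) ((((j + 2).choose 2 : ℕ) : PowerSeries ℚ)))) ((j : PowerSeries ℚ) * 2 ^ j)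
    have hC := dvd_mul_of_dvd_right (dvd_mul_of_dvd_right (hστ (j + 1)) (((j + 2 : ℕ) : PowerSeries ℚ)))
      (if 2 ≤ j then (2 : PowerSeries ℚ) ^ (j - 2) * ((j : PowerSeries ℚ) ^ 2 - 3 * (j : PowerSeries ℚ) + 4) else 0)
    have hD := dvd_mul_of_dvd_right (hσpow (j + 2)) (if 2 ≤ j then PowerSeries.C (t (j + 1)) else 0)
    have hE := dvd_mul_of_dvd_right (dvd_mul_of_dvd_right (hστ (j + 2)) (((j + 3 : ℕ) : PowerSeries ℚ)))
      (((j.choose 3 : ℕ) : PowerSeries ℚ) * 2 ^ (j - 1))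
    have hF := dvd_mul_of_dvd_right (hσpow (j + 3)) (if 3 ≤ j then PowerSeries.C (s (j + 1)) else 0)
    have hall := dvd_add (dvd_add (dvd_add (dvd_add (dvd_sub hA hB) hC) hD) hE) hF
    refine (hall.trans ?_)
    apply dvd_of_eq
    ring
  -- (4) `96ι⁴ · M` in closed form
  have hι1 : ι = 1 - 2 * X * ι := by linear_combination hF1
  have hsum := alg4_model_sum (2 * X * ι) ι hι1 K
  have hgeom := alg4_geom_lin (2 * X * ι) ι hι1 K
  have h96M : 96 * ι ^ 4 * M = -(∑ j ∈ Finset.range (K + 1), (2 * X * ι) ^ (j + 1) *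
      (-(12 : PowerSeries ℚ) * ((j : PowerSeries ℚ) + 2) * ((j : PowerSeries ℚ) + 1) * (2 * X * ι) ^ 5 * ι ^ 4 *
          (ι ^ 2 - (2 * X * ι) * ι + (2 * X * ι) ^ 2) +
        2 * ((j : PowerSeries ℚ) + 2) * ((j : PowerSeries ℚ) + 1) * (j : PowerSeries ℚ) * (2 * X * ι) ^ 6 * ι ^ 5 +
        12 * (j : PowerSeries ℚ) * ((j : PowerSeries ℚ) + 2) * (2 * X * ι) ^ 3 * ι ^ 4 * (ι ^ 2 - (2 * X * ι) * ι + (2 * X * ι) ^ 2) -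
        6 * (j : PowerSeries ℚ) * ((j : PowerSeries ℚ) + 2) * ((j : PowerSeries ℚ) + 1) * (2 * X * ι) ^ 4 * ι ^ 5 +
        6 * ((j : PowerSeries ℚ) ^ 2 - 3 * (j : PowerSeries ℚ) + 4) * ((j : PowerSeries ℚ) + 2) * (2 * X * ι) ^ 2 * ι ^ 5 +
        2 * (j : PowerSeries ℚ) * ((j : PowerSeries ℚ) - 1) * ((j : PowerSeries ℚ) - 2) * ((j : PowerSeries ℚ) + 3) * (2 * X * ι) ^ 2 * ι ^ 6)) +
      (∑ j ∈ Finset.range (K + 1), (if j = 0 then 384 * X ^ 3 * ι ^ 8 else if j = 1 then 576 * X ^ 4 * ι ^ 9 else 0)) -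
      96 * ι ^ 4 * Λ * (∑ j ∈ Finset.range (K + 1), ((j : PowerSeries ℚ) + 2) * (2 * X * ι) ^ (j + 1)) -
      96 * ι ^ 4 * (∑ j ∈ Finset.range (K + 1), X ^ (j + 1) * ((if 2 ≤ j then PowerSeries.C (t (j + 1)) else 0) * ι ^ (j + 2) +
        (if 3 ≤ j then PowerSeries.C (s (j + 1)) else 0) * ι ^ (j + 3))) := by
    rw [hM, mul_sub, mul_zero, zero_sub, Finset.mul_sum, Finset.mul_sum, Finset.mul_sum]
    have hj : ∀ j ∈ Finset.range (K + 1), 96 * ι ^ 4 * (X ^ (j + 1) *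
        ((2 : PowerSeries ℚ) ^ (j + 1) * ((((j + 2 : ℕ) : PowerSeries ℚ)) * ι ^ (j + 1) * Λ +
            2 * (((j + 2).choose 2 : ℕ) : PowerSeries ℚ) * ι ^ j * θ * κ + (((j + 2).choose 3 : ℕ) : PowerSeries ℚ) * ι ^ (j - 1) * θ ^ 3) -
          ((j : PowerSeries ℚ) * 2 ^ j) * ((((j + 2 : ℕ) : PowerSeries ℚ)) * ι ^ (j + 1) * κ +
            (((j + 2).choose 2 : ℕ) : PowerSeries ℚ) * ι ^ j * θ ^ 2) +
          (if 2 ≤ j then (2 : PowerSeries ℚ) ^ (j - 2) * ((j : PowerSeries ℚ) ^ 2 - 3 * (j : PowerSeries ℚ) + 4) else 0) * ((((j + 2 : ℕ) : PowerSeries ℚ)) * ι ^ (j + 1) * θ) +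
          (if 2 ≤ j then PowerSeries.C (t (j + 1)) else 0) * ι ^ (j + 2) +
          (((j.choose 3 : ℕ) : PowerSeries ℚ) * 2 ^ (j - 1)) * ((((j + 3 : ℕ) : PowerSeries ℚ)) * ι ^ (j + 2) * θ) +
          (if 3 ≤ j then PowerSeries.C (s (j + 1)) else 0) * ι ^ (j + 3))) =
        ((2 * X * ι) ^ (j + 1) *
      (-(12 : PowerSeries ℚ) * ((j : PowerSeries ℚ) + 2) * ((j : PowerSeries ℚ) + 1) * (2 * X * ι) ^ 5 * ι ^ 4 *
          (ι ^ 2 - (2 * X * ι) * ι + (2 * X * ι) ^ 2) +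
        2 * ((j : PowerSeries ℚ) + 2) * ((j : PowerSeries ℚ) + 1) * (j : PowerSeries ℚ) * (2 * X * ι) ^ 6 * ι ^ 5 +
        12 * (j : PowerSeries ℚ) * ((j : PowerSeries ℚ) + 2) * (2 * X * ι) ^ 3 * ι ^ 4 * (ι ^ 2 - (2 * X * ι) * ι + (2 * X * ι) ^ 2) -
        6 * (j : PowerSeries ℚ) * ((j : PowerSeries ℚ) + 2) * ((j : PowerSeries ℚ) + 1) * (2 * X * ι) ^ 4 * ι ^ 5 +
        6 * ((j : PowerSeries ℚ) ^ 2 - 3 * (j : PowerSeries ℚ) + 4) * ((j : PowerSeries ℚ) + 2) * (2 * X * ι) ^ 2 * ι ^ 5 +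
        2 * (j : PowerSeries ℚ) * ((j : PowerSeries ℚ) - 1) * ((j : PowerSeries ℚ) - 2) * ((j : PowerSeries ℚ) + 3) * (2 * X * ι) ^ 2 * ι ^ 6) - (if j = 0 then 384 * X ^ 3 * ι ^ 8 else if j = 1 then 576 * X ^ 4 * ι ^ 9 else 0)) +
        96 * ι ^ 4 * Λ * (((j : PowerSeries ℚ) + 2) * (2 * X * ι) ^ (j + 1)) +
        96 * ι ^ 4 * (X ^ (j + 1) * ((if 2 ≤ j then PowerSeries.C (t (j + 1)) else 0) * ι ^ (j + 2) +
        (if 3 ≤ j then PowerSeries.C (s (j + 1)) else 0) * ι ^ (j + 3))) := by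
      intro j _
      have ht := alg4_term j X ι
      rw [hθ, hκ]
      push_cast at ht ⊢
      linear_combination ht
    rw [Finset.sum_congr rfl hj, Finset.sum_add_distrib, Finset.sum_add_distrib, Finset.sum_sub_distrib]
    ring
  rw [hsum] at h96M
  -- (5) the corrections
  have hcorr : X ^ (K + 2) ∣ (∑ j ∈ Finset.range (K + 1), (if j = 0 then 384 * X ^ 3 * ι ^ 8 else if j = 1 then 576 * X ^ 4 * ι ^ 9 else 0)) -
      384 * X ^ 3 * ι ^ 8 - 576 * X ^ 4 * ι ^ 9 := by
    rcases K with _ | K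
    · rw [Finset.sum_range_one, if_pos rfl]
      exact Dvd.intro (-(576 * X ^ 2 * ι ^ 9)) (by ring)
    · rw [Finset.sum_eq_add_of_mem 0 1 (Finset.mem_range.2 (by omega)) (Finset.mem_range.2 (by omega)) (by omega)
        (fun c _ hc => by rw [if_neg hc.1, if_neg hc.2]), if_pos rfl, if_neg (by omega : (1 : ℕ) ≠ 0), if_pos rfl]
      simp
  -- (6) assemble with the unit `96 ι⁶`
  have hclose := alg4_close X ι hF1
  have h1ι : 1 - ι ^ 2 = X * (2 * ι * (1 + ι)) := by linear_combination (-(1 + ι)) * hF1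
  apply alg4_dvd_of_dvd_unit_mul 6 96 (by norm_num)
  rw [show PowerSeries.C (96 : ℚ) = 96 from map_ofNat _ 96, ← hι]
  have key : ∀ a : PowerSeries ℚ, 96 * ι ^ 6 * (a - (Λ0 - ι ^ 2 * (∑ j ∈ Finset.range (K + 1), X ^ (j + 1) * ((if 2 ≤ j then PowerSeries.C (t (j + 1)) else 0) * ι ^ (j + 2) +
        (if 3 ≤ j then PowerSeries.C (s (j + 1)) else 0) * ι ^ (j + 3))))) =
      ι ^ 2 * (96 * ι ^ 4 * (a - M)) + (ι ^ 2 * (96 * ι ^ 4 * M) - 96 * ι ^ 6 * (Λ0 - ι ^ 2 * (∑ j ∈ Finset.range (K + 1), X ^ (j + 1) * ((if 2 ≤ j then PowerSeries.C (t (j + 1)) else 0) * ι ^ (j + 2) +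
        (if 3 ≤ j then PowerSeries.C (s (j + 1)) else 0) * ι ^ (j + 3))))) := fun a => by ring
  rw [key, h96M]
  refine dvd_add (dvd_mul_of_dvd_right (dvd_mul_of_dvd_right hdiff _) _) ?_
  have key2 : ι ^ 2 * (-((48 * (2 * X * ι) ^ 3 - 204 * (2 * X * ι) ^ 4 + 384 * (2 * X * ι) ^ 5 - 384 * (2 * X * ι) ^ 6 + 348 * (2 * X * ι) ^ 7 - 288 * (2 * X * ι) ^ 8 + 96 * (2 * X * ι) ^ 9) +
      (2 * X * ι) ^ (K + 2) * ((-2 * (K : PowerSeries ℚ) ^ 4 - 14 * (K : PowerSeries ℚ) ^ 3 - 10 * (K : PowerSeries ℚ) ^ 2 + 14 * (K : PowerSeries ℚ) - 36) * (2 * X * ι) ^ 2 +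
        (10 * (K : PowerSeries ℚ) ^ 4 + 56 * (K : PowerSeries ℚ) ^ 3 - 28 * (K : PowerSeries ℚ) ^ 2 - 182 * (K : PowerSeries ℚ) + 96) * (2 * X * ι) ^ 3 +
        (-20 * (K : PowerSeries ℚ) ^ 4 - 78 * (K : PowerSeries ℚ) ^ 3 + 230 * (K : PowerSeries ℚ) ^ 2 + 552 * (K : PowerSeries ℚ) - 120) * (2 * X * ι) ^ 4 +
        (20 * (K : PowerSeries ℚ) ^ 4 + 32 * (K : PowerSeries ℚ) ^ 3 - 464 * (K : PowerSeries ℚ) ^ 2 - 800 * (K : PowerSeries ℚ) + 60) * (2 * X * ι) ^ 5 +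
        (-10 * (K : PowerSeries ℚ) ^ 4 + 20 * (K : PowerSeries ℚ) ^ 3 + 394 * (K : PowerSeries ℚ) ^ 2 + 448 * (K : PowerSeries ℚ) - 264) * (2 * X * ι) ^ 6 +
        (2 * (K : PowerSeries ℚ) ^ 4 - 16 * (K : PowerSeries ℚ) ^ 3 - 26 * (K : PowerSeries ℚ) ^ 2 + 424 * (K : PowerSeries ℚ) + 720) * (2 * X * ι) ^ 7 +
        (-6 * (K : PowerSeries ℚ) ^ 3 - 228 * (K : PowerSeries ℚ) ^ 2 - 870 * (K : PowerSeries ℚ) - 744) * (2 * X * ι) ^ 8 +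
        (8 * (K : PowerSeries ℚ) ^ 3 + 174 * (K : PowerSeries ℚ) ^ 2 + 526 * (K : PowerSeries ℚ) + 360) * (2 * X * ι) ^ 9 +
        (-2 * (K : PowerSeries ℚ) ^ 3 - 42 * (K : PowerSeries ℚ) ^ 2 - 112 * (K : PowerSeries ℚ) - 72) * (2 * X * ι) ^ 10)) +
      (∑ j ∈ Finset.range (K + 1), (if j = 0 then 384 * X ^ 3 * ι ^ 8 else if j = 1 then 576 * X ^ 4 * ι ^ 9 else 0)) -
      96 * ι ^ 4 * Λ * (∑ j ∈ Finset.range (K + 1), ((j : PowerSeries ℚ) + 2) * (2 * X * ι) ^ (j + 1)) -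
      96 * ι ^ 4 * (∑ j ∈ Finset.range (K + 1), X ^ (j + 1) * ((if 2 ≤ j then PowerSeries.C (t (j + 1)) else 0) * ι ^ (j + 2) +
        (if 3 ≤ j then PowerSeries.C (s (j + 1)) else 0) * ι ^ (j + 3)))) -
      96 * ι ^ 6 * (Λ0 - ι ^ 2 * (∑ j ∈ Finset.range (K + 1), X ^ (j + 1) * ((if 2 ≤ j then PowerSeries.C (t (j + 1)) else 0) * ι ^ (j + 2) +
        (if 3 ≤ j then PowerSeries.C (s (j + 1)) else 0) * ι ^ (j + 3)))) =
      ι ^ 2 * ((∑ j ∈ Finset.range (K + 1), (if j = 0 then 384 * X ^ 3 * ι ^ 8 else if j = 1 then 576 * X ^ 4 * ι ^ 9 else 0)) - 384 * X ^ 3 * ι ^ 8 - 576 * X ^ 4 * ι ^ 9) +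
      -(ι ^ 2 * ((2 * X * ι) ^ (K + 2) * ((-2 * (K : PowerSeries ℚ) ^ 4 - 14 * (K : PowerSeries ℚ) ^ 3 - 10 * (K : PowerSeries ℚ) ^ 2 + 14 * (K : PowerSeries ℚ) - 36) * (2 * X * ι) ^ 2 +
        (10 * (K : PowerSeries ℚ) ^ 4 + 56 * (K : PowerSeries ℚ) ^ 3 - 28 * (K : PowerSeries ℚ) ^ 2 - 182 * (K : PowerSeries ℚ) + 96) * (2 * X * ι) ^ 3 +
        (-20 * (K : PowerSeries ℚ) ^ 4 - 78 * (K : PowerSeries ℚ) ^ 3 + 230 * (K : PowerSeries ℚ) ^ 2 + 552 * (K : PowerSeries ℚ) - 120) * (2 * X * ι) ^ 4 +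
        (20 * (K : PowerSeries ℚ) ^ 4 + 32 * (K : PowerSeries ℚ) ^ 3 - 464 * (K : PowerSeries ℚ) ^ 2 - 800 * (K : PowerSeries ℚ) + 60) * (2 * X * ι) ^ 5 +
        (-10 * (K : PowerSeries ℚ) ^ 4 + 20 * (K : PowerSeries ℚ) ^ 3 + 394 * (K : PowerSeries ℚ) ^ 2 + 448 * (K : PowerSeries ℚ) - 264) * (2 * X * ι) ^ 6 +
        (2 * (K : PowerSeries ℚ) ^ 4 - 16 * (K : PowerSeries ℚ) ^ 3 - 26 * (K : PowerSeries ℚ) ^ 2 + 424 * (K : PowerSeries ℚ) + 720) * (2 * X * ι) ^ 7 +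
        (-6 * (K : PowerSeries ℚ) ^ 3 - 228 * (K : PowerSeries ℚ) ^ 2 - 870 * (K : PowerSeries ℚ) - 744) * (2 * X * ι) ^ 8 +
        (8 * (K : PowerSeries ℚ) ^ 3 + 174 * (K : PowerSeries ℚ) ^ 2 + 526 * (K : PowerSeries ℚ) + 360) * (2 * X * ι) ^ 9 +
        (-2 * (K : PowerSeries ℚ) ^ 3 - 42 * (K : PowerSeries ℚ) ^ 2 - 112 * (K : PowerSeries ℚ) - 72) * (2 * X * ι) ^ 10))) +
      96 * ι ^ 4 * Λ * (((K : PowerSeries ℚ) + 3) * (2 * X * ι) ^ (K + 2) - ((K : PowerSeries ℚ) + 2) * (2 * X * ι) ^ (K + 3)) +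
      -(96 * ι ^ 6 * (X * (2 * ι * (1 + ι))) * (X ^ (K + 1) * ((if 2 ≤ K then PowerSeries.C (t (K + 1)) else 0) * ι ^ (K + 2) +
        (if 3 ≤ K then PowerSeries.C (s (K + 1)) else 0) * ι ^ (K + 3)))) := by
    rw [hT, hΛ, hT0, hΛ0]
    linear_combination (-96 * ι ^ 4 * (-(4 * X ^ 5 * (7 + 12 * X + 60 * X ^ 2 + 40 * X ^ 3) * ι ^ 7) - ι ^ 2 * (∑ j ∈ Finset.range K, X ^ (j + 1) * ((if 2 ≤ j then PowerSeries.C (t (j + 1)) else 0) * ι ^ (j + 2) +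
        (if 3 ≤ j then PowerSeries.C (s (j + 1)) else 0) * ι ^ (j + 3))))) * hgeom +
      (-ι ^ 2) * hclose +
      (-(96 * ι ^ 6 * (X ^ (K + 1) * ((if 2 ≤ K then PowerSeries.C (t (K + 1)) else 0) * ι ^ (K + 2) +
        (if 3 ≤ K then PowerSeries.C (s (K + 1)) else 0) * ι ^ (K + 3))))) * h1ι
  rw [key2]
  refine dvd_add (dvd_add (dvd_add (dvd_mul_of_dvd_right hcorr _) ?_) ?_) ?_
  · rw [dvd_neg]
    exact dvd_mul_of_dvd_right (dvd_mul_of_dvd_left (pow_dvd_pow_of_dvd hwX _) _) _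
  · refine dvd_mul_of_dvd_right (dvd_sub ?_ ?_) _
    · exact dvd_mul_of_dvd_right (pow_dvd_pow_of_dvd hwX _) _
    · exact dvd_mul_of_dvd_right ((pow_dvd_pow_of_dvd hwX (K + 3)) |> fun h => (pow_dvd_pow X (by omega : K + 2 ≤ K + 3)).trans h) _
  · rw [dvd_neg, show 96 * ι ^ 6 * (X * (2 * ι * (1 + ι))) * (X ^ (K + 1) * ((if 2 ≤ K then PowerSeries.C (t (K + 1)) else 0) * ι ^ (K + 2) +
        (if 3 ≤ K then PowerSeries.C (s (K + 1)) else 0) * ι ^ (K + 3))) =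
        X ^ (K + 2) * (96 * ι ^ 6 * (2 * ι * (1 + ι)) * ((if 2 ≤ K then PowerSeries.C (t (K + 1)) else 0) * ι ^ (K + 2) +
        (if 3 ≤ K then PowerSeries.C (s (K + 1)) else 0) * ι ^ (K + 3))) by ring]
    exact Dvd.intro _ rfl

end Step4


/-! ### Part III — kernels and the fourth symbol of the inverse series `E_k` -/

section Inverse4

/-- The fourth geometric identity (times six): `6(1 − w)⁴ Σ_{m<n} C(m+3,3) w^m = 6 + w^n Q_n(w)` with
`Q_n(w) = −(n³+6n²+11n+6) + (3n³+15n²+18n) w − (3n³+12n²+9n) w² + (n³+3n²+2n) w³`.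
[cite: MadrasSlade1993, §1.1 eq. (1.1.8) p. 5; lane plumbing] -/
private theorem alg4_geom4 (w : PowerSeries ℚ) (n : ℕ) :
    6 * (1 - w) ^ 4 * ∑ m ∈ Finset.range n, (((m + 3).choose 3 : ℕ) : PowerSeries ℚ) * w ^ m =
      6 + w ^ n * (-((n : PowerSeries ℚ) ^ 3 + 6 * (n : PowerSeries ℚ) ^ 2 + 11 * (n : PowerSeries ℚ) + 6) +
        (3 * (n : PowerSeries ℚ) ^ 3 + 15 * (n : PowerSeries ℚ) ^ 2 + 18 * (n : PowerSeries ℚ)) * w -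
        (3 * (n : PowerSeries ℚ) ^ 3 + 12 * (n : PowerSeries ℚ) ^ 2 + 9 * (n : PowerSeries ℚ)) * w ^ 2 +
        ((n : PowerSeries ℚ) ^ 3 + 3 * (n : PowerSeries ℚ) ^ 2 + 2 * (n : PowerSeries ℚ)) * w ^ 3) := by
  induction n with
  | zero => rw [Finset.sum_range_zero]; push_cast; ring
  | succ n ih =>
    rw [Finset.sum_range_succ, mul_add, ih]
    have e3 := alg4_six_mul_cast_choose_three (n + 3)
    push_cast at e3 ⊢
    linear_combination ((1 - w) ^ 4 * w ^ n) * e3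

/-- `Σ_n (n+1)(−2)^n X^n = ι²`. [cite: MadrasSlade1993, §1.1 eq. (1.1.8) p. 5; lane plumbing] -/
private theorem alg4_iota_sq :
    PowerSeries.mk (fun n : ℕ => ((n : ℚ) + 1) * (-2 : ℚ) ^ n) = PowerSeries.mk (fun i : ℕ => (-2 : ℚ) ^ i) ^ 2 := by
  have hF1 := alg4_iota_mul
  have h2 : (1 + PowerSeries.C (2 : ℚ) * PowerSeries.X) * PowerSeries.mk (fun n : ℕ => ((n : ℚ) + 1) * (-2 : ℚ) ^ n) =
      PowerSeries.mk (fun i : ℕ => (-2 : ℚ) ^ i) := by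
    ext n
    rw [add_mul, one_mul, map_add, PowerSeries.coeff_mk, mul_assoc, PowerSeries.coeff_C_mul, PowerSeries.coeff_mk]
    rcases n with _ | n
    · rw [PowerSeries.coeff_zero_X_mul, mul_zero, add_zero]; norm_num
    · rw [PowerSeries.coeff_succ_X_mul, PowerSeries.coeff_mk, pow_succ]; push_cast; ring
  calc PowerSeries.mk (fun n : ℕ => ((n : ℚ) + 1) * (-2 : ℚ) ^ n)
      = ((1 + PowerSeries.C (2 : ℚ) * PowerSeries.X) * PowerSeries.mk (fun i : ℕ => (-2 : ℚ) ^ i)) *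
          PowerSeries.mk (fun n : ℕ => ((n : ℚ) + 1) * (-2 : ℚ) ^ n) := by rw [hF1, one_mul]
    _ = PowerSeries.mk (fun i : ℕ => (-2 : ℚ) ^ i) *
          ((1 + PowerSeries.C (2 : ℚ) * PowerSeries.X) * PowerSeries.mk (fun n : ℕ => ((n : ℚ) + 1) * (-2 : ℚ) ^ n)) := by ring
    _ = _ := by rw [h2, pow_two]

/-- `Σ_n C(n+r+1, r+1)(−2)^n X^n = ι · Σ_n C(n+r, r)(−2)^n X^n`: one more factor of `ι`. [cite: MadrasSlade1993, §1.1 eq. (1.1.8) p. 5; lane plumbing] -/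
private theorem alg4_iota_choose_succ (r : ℕ) :
    PowerSeries.mk (fun n : ℕ => (((n + r + 1).choose (r + 1) : ℕ) : ℚ) * (-2 : ℚ) ^ n) =
      PowerSeries.mk (fun i : ℕ => (-2 : ℚ) ^ i) * PowerSeries.mk (fun n : ℕ => (((n + r).choose r : ℕ) : ℚ) * (-2 : ℚ) ^ n) := by
  have hF1 := alg4_iota_mul
  have h2 : (1 + PowerSeries.C (2 : ℚ) * PowerSeries.X) * PowerSeries.mk (fun n : ℕ => (((n + r + 1).choose (r + 1) : ℕ) : ℚ) * (-2 : ℚ) ^ n) =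
      PowerSeries.mk (fun n : ℕ => (((n + r).choose r : ℕ) : ℚ) * (-2 : ℚ) ^ n) := by
    ext n
    rw [add_mul, one_mul, map_add, PowerSeries.coeff_mk, mul_assoc, PowerSeries.coeff_C_mul, PowerSeries.coeff_mk]
    rcases n with _ | n
    · rw [PowerSeries.coeff_zero_X_mul, mul_zero, add_zero]; simp
    · rw [PowerSeries.coeff_succ_X_mul, PowerSeries.coeff_mk, pow_succ, show n + 1 + r + 1 = (n + r + 1) + 1 by omega,
        Nat.choose_succ_succ' (n + r + 1) r, show n + 1 + r = n + r + 1 by omega]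
      push_cast; ring
  calc PowerSeries.mk (fun n : ℕ => (((n + r + 1).choose (r + 1) : ℕ) : ℚ) * (-2 : ℚ) ^ n)
      = ((1 + PowerSeries.C (2 : ℚ) * PowerSeries.X) * PowerSeries.mk (fun i : ℕ => (-2 : ℚ) ^ i)) *
          PowerSeries.mk (fun n : ℕ => (((n + r + 1).choose (r + 1) : ℕ) : ℚ) * (-2 : ℚ) ^ n) := by rw [hF1, one_mul]
    _ = PowerSeries.mk (fun i : ℕ => (-2 : ℚ) ^ i) *
          ((1 + PowerSeries.C (2 : ℚ) * PowerSeries.X) *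
            PowerSeries.mk (fun n : ℕ => (((n + r + 1).choose (r + 1) : ℕ) : ℚ) * (-2 : ℚ) ^ n)) := by ring
    _ = _ := by rw [h2]

/-- `Σ_n C(n+r, r)(−2)^n X^n = ι^{r+1}`. [cite: MadrasSlade1993, §1.1 eq. (1.1.8) p. 5; lane plumbing] -/
private theorem alg4_iota_pow (r : ℕ) :
    PowerSeries.mk (fun n : ℕ => (((n + r).choose r : ℕ) : ℚ) * (-2 : ℚ) ^ n) = PowerSeries.mk (fun i : ℕ => (-2 : ℚ) ^ i) ^ (r + 1) := by
  induction r with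
  | zero => rw [zero_add, pow_one]; congr 1; ext n; simp
  | succ r ih =>
    rw [show (PowerSeries.mk fun n : ℕ => (((n + (r + 1)).choose (r + 1) : ℕ) : ℚ) * (-2 : ℚ) ^ n) =
        PowerSeries.mk (fun n : ℕ => (((n + r + 1).choose (r + 1) : ℕ) : ℚ) * (-2 : ℚ) ^ n) by simp_rw [← add_assoc],
      alg4_iota_choose_succ, ih, pow_succ' _ (r + 1)]

/-- `[X^k] (4X⁵(5 + 14X + 52X² + 40X³) ι⁵) = (−2)^k (−3k⁴ + 38k³ − 165k² + 214k + 120)/96` for `k ≥ 4`.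
[cite: MadrasSlade1993, §1.1 eq. (1.1.8) p. 5; lane plumbing] -/
private theorem alg4_coeff_G {k : ℕ} (hk : 4 ≤ k) :
    PowerSeries.coeff k (PowerSeries.C (4 : ℚ) * PowerSeries.X ^ 5 *
      (PowerSeries.C (5 : ℚ) + PowerSeries.C (14 : ℚ) * PowerSeries.X + PowerSeries.C (52 : ℚ) * PowerSeries.X ^ 2 +
        PowerSeries.C (40 : ℚ) * PowerSeries.X ^ 3) *
      PowerSeries.mk (fun i : ℕ => (-2 : ℚ) ^ i) ^ 5) =
      (-2 : ℚ) ^ k * (-3 * (k : ℚ) ^ 4 + 38 * (k : ℚ) ^ 3 - 165 * (k : ℚ) ^ 2 + 214 * (k : ℚ) + 120) / 96 := by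
  rw [← alg4_iota_pow 4]
  set F : PowerSeries ℚ := PowerSeries.mk (fun n : ℕ => (((n + 4).choose 4 : ℕ) : ℚ) * (-2 : ℚ) ^ n) with hF
  have hsplit : PowerSeries.C (4 : ℚ) * PowerSeries.X ^ 5 *
      (PowerSeries.C (5 : ℚ) + PowerSeries.C (14 : ℚ) * PowerSeries.X + PowerSeries.C (52 : ℚ) * PowerSeries.X ^ 2 +
        PowerSeries.C (40 : ℚ) * PowerSeries.X ^ 3) * F =
      PowerSeries.X ^ 5 * (PowerSeries.C (20 : ℚ) * F) + PowerSeries.X ^ 6 * (PowerSeries.C (56 : ℚ) * F) +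
        PowerSeries.X ^ 7 * (PowerSeries.C (208 : ℚ) * F) + PowerSeries.X ^ 8 * (PowerSeries.C (160 : ℚ) * F) := by
    rw [show PowerSeries.C (20 : ℚ) = PowerSeries.C 4 * PowerSeries.C 5 by rw [← map_mul]; norm_num,
      show PowerSeries.C (56 : ℚ) = PowerSeries.C 4 * PowerSeries.C 14 by rw [← map_mul]; norm_num,
      show PowerSeries.C (208 : ℚ) = PowerSeries.C 4 * PowerSeries.C 52 by rw [← map_mul]; norm_num,
      show PowerSeries.C (160 : ℚ) = PowerSeries.C 4 * PowerSeries.C 40 by rw [← map_mul]; norm_num]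
    ring
  have hchoose : ∀ n : ℕ, (((n + 4).choose 4 : ℕ) : ℚ) = ((n : ℚ) + 1) * ((n : ℚ) + 2) * ((n : ℚ) + 3) * ((n : ℚ) + 4) / 24 := by
    intro n
    have h := Nat.add_one_mul_choose_eq (n + 3) 3
    have h' := Nat.add_one_mul_choose_eq (n + 2) 2
    have h'' := Nat.add_one_mul_choose_eq (n + 1) 1
    rw [Nat.choose_one_right] at h''
    have e : (24 : ℚ) * (((n + 4).choose 4 : ℕ) : ℚ) = ((n : ℚ) + 1) * ((n : ℚ) + 2) * ((n : ℚ) + 3) * ((n : ℚ) + 4) := by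
      have q1 : ((n + 4 : ℕ) : ℚ) * (((n + 3).choose 3 : ℕ) : ℚ) = (((n + 4).choose 4 : ℕ) : ℚ) * 4 := by exact_mod_cast h
      have q2 : ((n + 3 : ℕ) : ℚ) * (((n + 2).choose 2 : ℕ) : ℚ) = (((n + 3).choose 3 : ℕ) : ℚ) * 3 := by exact_mod_cast h'
      have q3 : ((n + 2 : ℕ) : ℚ) * ((n + 1 : ℕ) : ℚ) = (((n + 2).choose 2 : ℕ) : ℚ) * 2 := by exact_mod_cast h''
      push_cast at q1 q2 q3
      linear_combination (-6) * q1 - 2 * ((n : ℚ) + 4) * q2 - ((n : ℚ) + 4) * ((n : ℚ) + 3) * q3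
    linear_combination e / 24
  rw [hsplit, map_add, map_add, map_add, PowerSeries.coeff_X_pow_mul', PowerSeries.coeff_X_pow_mul', PowerSeries.coeff_X_pow_mul',
    PowerSeries.coeff_X_pow_mul']
  have hm2 : (-2 : ℚ) = (-1) * 2 := by norm_num
  by_cases h8 : 8 ≤ k
  · rw [if_pos (by omega), if_pos (by omega), if_pos (by omega), if_pos h8, PowerSeries.coeff_C_mul, PowerSeries.coeff_C_mul,
      PowerSeries.coeff_C_mul, PowerSeries.coeff_C_mul, hF, PowerSeries.coeff_mk, PowerSeries.coeff_mk, PowerSeries.coeff_mk,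
      PowerSeries.coeff_mk, hchoose, hchoose, hchoose, hchoose]
    obtain ⟨m, rfl⟩ : ∃ m, k = m + 8 := ⟨k - 8, by omega⟩
    rw [show m + 8 - 5 = m + 3 by omega, show m + 8 - 6 = m + 2 by omega, show m + 8 - 7 = m + 1 by omega, Nat.add_sub_cancel]
    push_cast
    ring
  · by_cases h7 : 7 ≤ k
    · obtain rfl : k = 7 := by omega
      rw [if_pos (by omega), if_pos (by omega), if_pos (by omega), if_neg (by omega), add_zero, PowerSeries.coeff_C_mul,
        PowerSeries.coeff_C_mul, PowerSeries.coeff_C_mul, hF, PowerSeries.coeff_mk, PowerSeries.coeff_mk, PowerSeries.coeff_mk]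
      norm_num [Nat.choose]
    · by_cases h6 : 6 ≤ k
      · obtain rfl : k = 6 := by omega
        rw [if_pos (by omega), if_pos (by omega), if_neg (by omega), if_neg (by omega), add_zero, add_zero, PowerSeries.coeff_C_mul,
          PowerSeries.coeff_C_mul, hF, PowerSeries.coeff_mk, PowerSeries.coeff_mk]
        norm_num [Nat.choose]
      · by_cases h5 : 5 ≤ k
        · obtain rfl : k = 5 := by omega
          rw [if_pos (by omega), if_neg (by omega), if_neg (by omega), if_neg (by omega), add_zero, add_zero, add_zero,
            PowerSeries.coeff_C_mul, hF, PowerSeries.coeff_mk]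
          norm_num [Nat.choose]
        · obtain rfl : k = 4 := by omega
          rw [if_neg (by omega), if_neg (by omega), if_neg (by omega), if_neg (by omega)]
          norm_num

/-- The second geometric identity: `(1 − w)² Σ_{m<k} (m+1) w^m = 1 − (k+1) w^k + k w^{k+1}`.
[cite: MadrasSlade1993, §1.1 eq. (1.1.8) p. 5; lane plumbing] -/
private theorem alg4_geom2 (w : PowerSeries ℚ) (k : ℕ) :
    (1 - w) ^ 2 * ∑ m ∈ Finset.range k, ((m + 1 : ℕ) : PowerSeries ℚ) * w ^ m =
      1 - ((k + 1 : ℕ) : PowerSeries ℚ) * w ^ k + ((k : ℕ) : PowerSeries ℚ) * w ^ (k + 1) := by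
  induction k with
  | zero => rw [Finset.sum_range_zero]; push_cast; ring
  | succ k ih => rw [Finset.sum_range_succ, mul_add, ih]; push_cast; ring

/-- The third geometric identity (doubled): `2(1 − w)³ Σ_{m<n} C(m+2,2) w^m = 2 + w^n Q_n(w)` with
`Q_n(w) = −(n²+3n+2) + (2n²+4n) w − (n²+n) w²`. [cite: MadrasSlade1993, §1.1 eq. (1.1.8) p. 5; lane plumbing] -/
private theorem alg4_geom3 (w : PowerSeries ℚ) (n : ℕ) :
    2 * (1 - w) ^ 3 * ∑ m ∈ Finset.range n, (((m + 2).choose 2 : ℕ) : PowerSeries ℚ) * w ^ m =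
      2 + w ^ n * (-((n : PowerSeries ℚ) ^ 2 + 3 * (n : PowerSeries ℚ) + 2) +
        (2 * (n : PowerSeries ℚ) ^ 2 + 4 * (n : PowerSeries ℚ)) * w - ((n : PowerSeries ℚ) ^ 2 + (n : PowerSeries ℚ)) * w ^ 2) := by
  induction n with
  | zero => rw [Finset.sum_range_zero]; push_cast; ring
  | succ n ih =>
    rw [Finset.sum_range_succ, mul_add, ih]
    have e2 := alg4_two_mul_cast_choose_two (n + 2)
    push_cast at e2 ⊢
    linear_combination ((1 - w) ^ 3 * w ^ n) * e2

/-- ★ THE FOURTH SYMBOL OF THE INVERSE SERIES: if `σ ≡ ι`, `τ ≡ θ`, `υ ≡ κ` and `μ ≡ Λ_k = λ₀ − ι² T_k (mod X^{k+1})`, then the fourth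
symbol polynomial of `E_k = Σ_{j ≤ k} (1 − A_k)^j` (family quadruple `(1 − σ, −τ, −υ, −μ)`, powers by `symbolQuad_pow`), namely
`Σ_{j ≤ k} (j (1−σ)^{j−1}(−μ) + 2 C(j,2) (1−σ)^{j−2} τυ − C(j,3) (1−σ)^{j−3} τ³)`, has the same `X^k`-coefficient as
`G₄⁰ + T_k`, `G₄⁰ = 4X⁵(5 + 14X + 52X² + 40X³)ι⁵`: modulo `X^{k+1}` the polynomial is `−Λ_k/ι² + 2θκ/ι³ − θ³/ι⁴` (the three geometric
sums close up by `alg4_geom2/3/4`), and `−λ₀ι² + 2θκι − θ³ = 4X⁵(5 + 14X + 52X² + 40X³)ι⁹` (pure ring). [cite: MadrasSlade1993, §1.1 eq. (1.1.8) p. 5; lane lemma] -/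
private theorem alg4_E (t s : ℕ → ℚ) {k : ℕ} {σ τ υ μ : Polynomial ℚ} (hk : 3 ≤ k)
    (hσ : (PowerSeries.X : PowerSeries ℚ) ^ (k + 1) ∣ ((σ : PowerSeries ℚ) - PowerSeries.mk (fun i : ℕ => (-2 : ℚ) ^ i)))
    (hτ : (PowerSeries.X : PowerSeries ℚ) ^ (k + 1) ∣ ((τ : PowerSeries ℚ) -
      PowerSeries.C (2 : ℚ) * PowerSeries.X ^ 2 * PowerSeries.mk (fun i : ℕ => (-2 : ℚ) ^ i) ^ 3))
    (hυ : (PowerSeries.X : PowerSeries ℚ) ^ (k + 1) ∣ ((υ : PowerSeries ℚ) -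
      -(PowerSeries.C (2 : ℚ) * PowerSeries.X ^ 3 * (1 - PowerSeries.C (2 : ℚ) * PowerSeries.X + PowerSeries.C (4 : ℚ) * PowerSeries.X ^ 2) *
        PowerSeries.mk (fun i : ℕ => (-2 : ℚ) ^ i) ^ 5)))
    (hμ : (PowerSeries.X : PowerSeries ℚ) ^ (k + 1) ∣ ((μ : PowerSeries ℚ) -
      ((-(4 * PowerSeries.X ^ 5 * (7 + 12 * PowerSeries.X + 60 * PowerSeries.X ^ 2 + 40 * PowerSeries.X ^ 3) *
        PowerSeries.mk (fun i : ℕ => (-2 : ℚ) ^ i) ^ 7)) - PowerSeries.mk (fun i : ℕ => (-2 : ℚ) ^ i) ^ 2 *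
        (∑ j ∈ Finset.range k, PowerSeries.X ^ (j + 1) * ((if 2 ≤ j then PowerSeries.C (t (j + 1)) else 0) *
          PowerSeries.mk (fun i : ℕ => (-2 : ℚ) ^ i) ^ (j + 2) +
          (if 3 ≤ j then PowerSeries.C (s (j + 1)) else 0) * PowerSeries.mk (fun i : ℕ => (-2 : ℚ) ^ i) ^ (j + 3)))))) :
    (∑ j ∈ Finset.range (k + 1), ((j : Polynomial ℚ) * (1 - σ) ^ (j - 1) * (0 - μ) +
      2 * ((j.choose 2 : ℕ) : Polynomial ℚ) * (1 - σ) ^ (j - 2) * (0 - τ) * (0 - υ) +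
      ((j.choose 3 : ℕ) : Polynomial ℚ) * (1 - σ) ^ (j - 3) * (0 - τ) ^ 3)).coeff k =
    PowerSeries.coeff k (PowerSeries.C (4 : ℚ) * PowerSeries.X ^ 5 *
      (PowerSeries.C (5 : ℚ) + PowerSeries.C (14 : ℚ) * PowerSeries.X + PowerSeries.C (52 : ℚ) * PowerSeries.X ^ 2 +
        PowerSeries.C (40 : ℚ) * PowerSeries.X ^ 3) * PowerSeries.mk (fun i : ℕ => (-2 : ℚ) ^ i) ^ 5 +
      ∑ j ∈ Finset.range k, PowerSeries.X ^ (j + 1) * ((if 2 ≤ j then PowerSeries.C (t (j + 1)) else 0) *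
          PowerSeries.mk (fun i : ℕ => (-2 : ℚ) ^ i) ^ (j + 2) +
          (if 3 ≤ j then PowerSeries.C (s (j + 1)) else 0) * PowerSeries.mk (fun i : ℕ => (-2 : ℚ) ^ i) ^ (j + 3))) := by
  set ι : PowerSeries ℚ := PowerSeries.mk (fun i : ℕ => (-2 : ℚ) ^ i) with hι
  have hF1' : (1 + PowerSeries.C (2 : ℚ) * PowerSeries.X) * ι = 1 := alg4_iota_mul
  have hC2 : PowerSeries.C (2 : ℚ) = 2 := map_ofNat _ 2
  have hC4 : PowerSeries.C (4 : ℚ) = 4 := map_ofNat _ 4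
  have hC5 : PowerSeries.C (5 : ℚ) = 5 := map_ofNat _ 5
  have hC14 : PowerSeries.C (14 : ℚ) = 14 := map_ofNat _ 14
  have hC52 : PowerSeries.C (52 : ℚ) = 52 := map_ofNat _ 52
  have hC40 : PowerSeries.C (40 : ℚ) = 40 := map_ofNat _ 40
  rw [hC2] at hτ
  rw [hC2, hC4] at hυ
  rw [hC4, hC5, hC14, hC52, hC40]
  have hF1 : (1 + 2 * PowerSeries.X) * ι = 1 := by rw [← hC2]; exact hF1'
  -- the polynomial, mapped to power series
  have hQ : (((∑ j ∈ Finset.range (k + 1), ((j : Polynomial ℚ) * (1 - σ) ^ (j - 1) * (0 - μ) +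
      2 * ((j.choose 2 : ℕ) : Polynomial ℚ) * (1 - σ) ^ (j - 2) * (0 - τ) * (0 - υ) +
      ((j.choose 3 : ℕ) : Polynomial ℚ) * (1 - σ) ^ (j - 3) * (0 - τ) ^ 3) : Polynomial ℚ)) : PowerSeries ℚ) =
      ∑ j ∈ Finset.range (k + 1), (((j : ℕ) : PowerSeries ℚ) * (1 - (σ : PowerSeries ℚ)) ^ (j - 1) * (0 - (μ : PowerSeries ℚ)) +
        2 * ((j.choose 2 : ℕ) : PowerSeries ℚ) * (1 - (σ : PowerSeries ℚ)) ^ (j - 2) * (0 - (τ : PowerSeries ℚ)) * (0 - (υ : PowerSeries ℚ)) +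
        ((j.choose 3 : ℕ) : PowerSeries ℚ) * (1 - (σ : PowerSeries ℚ)) ^ (j - 3) * (0 - (τ : PowerSeries ℚ)) ^ 3) := by
    rw [← Polynomial.coeToPowerSeries.ringHom_apply, map_sum]
    refine Finset.sum_congr rfl fun j _ => ?_
    simp only [map_mul, map_pow, map_add, map_sub, map_one, map_zero, map_natCast, map_ofNat,
      Polynomial.coeToPowerSeries.ringHom_apply]
  set X : PowerSeries ℚ := PowerSeries.X with hX
  set T : PowerSeries ℚ := ∑ j ∈ Finset.range k, X ^ (j + 1) * ((if 2 ≤ j then PowerSeries.C (t (j + 1)) else 0) * ι ^ (j + 2) +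
    (if 3 ≤ j then PowerSeries.C (s (j + 1)) else 0) * ι ^ (j + 3)) with hT
  set w : PowerSeries ℚ := 1 - ι with hw
  set θ : PowerSeries ℚ := 2 * X ^ 2 * ι ^ 3 with hθ
  set κ : PowerSeries ℚ := -(2 * X ^ 3 * (1 - 2 * X + 4 * X ^ 2) * ι ^ 5) with hκ
  set Λ : PowerSeries ℚ := -(4 * X ^ 5 * (7 + 12 * X + 60 * X ^ 2 + 40 * X ^ 3) * ι ^ 7) - ι ^ 2 * T with hΛ
  have hw2 : 2 * X * ι = w := by rw [hw]; linear_combination hF1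
  have hwX : X ∣ w := by rw [← hw2]; exact Dvd.intro_left 2 (by ring) |>.mul_right ι
  have hθX : X ^ 2 ∣ θ := by rw [hθ]; exact Dvd.intro_left 2 (by ring) |>.mul_right _
  have hκX : X ^ 3 ∣ κ := by rw [hκ]; exact Dvd.intro (-(2 * (1 - 2 * X + 4 * X ^ 2) * ι ^ 5)) (by ring)
  have hTX : X ^ 3 ∣ T := by
    rw [hT]
    refine Finset.dvd_sum fun j _ => ?_
    by_cases hj : 2 ≤ j
    · exact dvd_mul_of_dvd_left (pow_dvd_pow X (by omega)) _
    · rw [if_neg hj, if_neg (by omega), zero_mul, zero_mul, add_zero, mul_zero]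
      exact dvd_zero _
  have hΛX : X ^ 3 ∣ Λ := by
    rw [hΛ]
    exact dvd_sub (Dvd.intro (-(4 * X ^ 2 * (7 + 12 * X + 60 * X ^ 2 + 40 * X ^ 3) * ι ^ 7)) (by ring))
      (dvd_mul_of_dvd_right hTX _)
  -- `1 − σ ≡ w` and its powers
  have h1σ : X ^ (k + 1) ∣ (1 - (σ : PowerSeries ℚ)) - w := by
    have : (1 - (σ : PowerSeries ℚ)) - w = -((σ : PowerSeries ℚ) - ι) := by rw [hw]; ring
    rw [this]; exact dvd_neg.2 hσ
  have h1σpow : ∀ m : ℕ, X ^ (k + 1) ∣ (1 - (σ : PowerSeries ℚ)) ^ m - w ^ m := fun m =>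
    h1σ.trans (sub_dvd_pow_sub_pow _ _ m)
  have hτ' : X ^ (k + 1) ∣ (τ : PowerSeries ℚ) - θ := hτ
  have hυ' : X ^ (k + 1) ∣ (υ : PowerSeries ℚ) - κ := hυ
  have hμ' : X ^ (k + 1) ∣ (μ : PowerSeries ℚ) - Λ := hμ
  -- the model sum and its distance to the actual one
  set M : PowerSeries ℚ := ∑ j ∈ Finset.range (k + 1), (((j : ℕ) : PowerSeries ℚ) * w ^ (j - 1) * (0 - Λ) +
      2 * ((j.choose 2 : ℕ) : PowerSeries ℚ) * w ^ (j - 2) * (0 - θ) * (0 - κ) +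
      ((j.choose 3 : ℕ) : PowerSeries ℚ) * w ^ (j - 3) * (0 - θ) ^ 3) with hM
  have hdiff1 : X ^ (k + 1) ∣
      (∑ j ∈ Finset.range (k + 1), (((j : ℕ) : PowerSeries ℚ) * (1 - (σ : PowerSeries ℚ)) ^ (j - 1) * (0 - (μ : PowerSeries ℚ)) +
        2 * ((j.choose 2 : ℕ) : PowerSeries ℚ) * (1 - (σ : PowerSeries ℚ)) ^ (j - 2) * (0 - (τ : PowerSeries ℚ)) * (0 - (υ : PowerSeries ℚ)) +
        ((j.choose 3 : ℕ) : PowerSeries ℚ) * (1 - (σ : PowerSeries ℚ)) ^ (j - 3) * (0 - (τ : PowerSeries ℚ)) ^ 3)) - M := by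
    rw [hM, ← Finset.sum_sub_distrib]
    refine Finset.dvd_sum fun j _ => ?_
    have : (((j : ℕ) : PowerSeries ℚ) * (1 - (σ : PowerSeries ℚ)) ^ (j - 1) * (0 - (μ : PowerSeries ℚ)) +
        2 * ((j.choose 2 : ℕ) : PowerSeries ℚ) * (1 - (σ : PowerSeries ℚ)) ^ (j - 2) * (0 - (τ : PowerSeries ℚ)) * (0 - (υ : PowerSeries ℚ)) +
        ((j.choose 3 : ℕ) : PowerSeries ℚ) * (1 - (σ : PowerSeries ℚ)) ^ (j - 3) * (0 - (τ : PowerSeries ℚ)) ^ 3) -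
        (((j : ℕ) : PowerSeries ℚ) * w ^ (j - 1) * (0 - Λ) +
          2 * ((j.choose 2 : ℕ) : PowerSeries ℚ) * w ^ (j - 2) * (0 - θ) * (0 - κ) +
          ((j.choose 3 : ℕ) : PowerSeries ℚ) * w ^ (j - 3) * (0 - θ) ^ 3) =
        -(((j : ℕ) : PowerSeries ℚ) * ((1 - (σ : PowerSeries ℚ)) ^ (j - 1) * ((μ : PowerSeries ℚ) - Λ) +
          ((1 - (σ : PowerSeries ℚ)) ^ (j - 1) - w ^ (j - 1)) * Λ)) +
        2 * ((j.choose 2 : ℕ) : PowerSeries ℚ) * ((1 - (σ : PowerSeries ℚ)) ^ (j - 2) *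
            ((τ : PowerSeries ℚ) * ((υ : PowerSeries ℚ) - κ) + ((τ : PowerSeries ℚ) - θ) * κ) +
          ((1 - (σ : PowerSeries ℚ)) ^ (j - 2) - w ^ (j - 2)) * (θ * κ)) -
        ((j.choose 3 : ℕ) : PowerSeries ℚ) * ((1 - (σ : PowerSeries ℚ)) ^ (j - 3) *
            (((τ : PowerSeries ℚ) - θ) * ((τ : PowerSeries ℚ) ^ 2 + (τ : PowerSeries ℚ) * θ + θ ^ 2)) +
          ((1 - (σ : PowerSeries ℚ)) ^ (j - 3) - w ^ (j - 3)) * θ ^ 3) := by ring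
    rw [this]
    refine dvd_sub (dvd_add ?_ ?_) ?_
    · exact dvd_neg.2 (dvd_mul_of_dvd_right (dvd_add (dvd_mul_of_dvd_right hμ' _) (dvd_mul_of_dvd_left (h1σpow _) _)) _)
    · exact dvd_mul_of_dvd_right (dvd_add (dvd_mul_of_dvd_right (dvd_add (dvd_mul_of_dvd_right hυ' _)
        (dvd_mul_of_dvd_left hτ' _)) _) (dvd_mul_of_dvd_left (h1σpow _) _)) _
    · exact dvd_mul_of_dvd_right (dvd_add (dvd_mul_of_dvd_right (dvd_mul_of_dvd_left hτ' _) _)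
        (dvd_mul_of_dvd_left (h1σpow _) _)) _
  -- the model in closed form
  obtain ⟨n, rfl⟩ : ∃ n, k = n + 3 := ⟨k - 3, by omega⟩
  have hsum1 : ∑ j ∈ Finset.range (n + 3 + 1), ((j : ℕ) : PowerSeries ℚ) * w ^ (j - 1) * (0 - Λ) =
      -(Λ * ∑ m ∈ Finset.range (n + 3), ((m + 1 : ℕ) : PowerSeries ℚ) * w ^ m) := by
    rw [Finset.sum_range_succ' (fun j => ((j : ℕ) : PowerSeries ℚ) * w ^ (j - 1) * (0 - Λ)) (n + 3)]
    simp only [Nat.cast_zero, zero_mul, add_zero, Nat.add_sub_cancel, Finset.mul_sum]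
    rw [← Finset.sum_neg_distrib]
    exact Finset.sum_congr rfl fun m _ => by ring
  have hsum2 : ∑ j ∈ Finset.range (n + 3 + 1), 2 * ((j.choose 2 : ℕ) : PowerSeries ℚ) * w ^ (j - 2) * (0 - θ) * (0 - κ) =
      2 * θ * κ * ∑ m ∈ Finset.range (n + 2), (((m + 2).choose 2 : ℕ) : PowerSeries ℚ) * w ^ m := by
    rw [Finset.sum_range_succ' (fun j => 2 * ((j.choose 2 : ℕ) : PowerSeries ℚ) * w ^ (j - 2) * (0 - θ) * (0 - κ)) (n + 3),
      Finset.sum_range_succ' (fun j => 2 * (((j + 1).choose 2 : ℕ) : PowerSeries ℚ) * w ^ (j + 1 - 2) * (0 - θ) * (0 - κ)) (n + 2)]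
    simp only [Nat.choose_zero_succ, show Nat.choose 1 2 = 0 by decide, Nat.cast_zero, mul_zero, zero_mul, add_zero,
      show ∀ m : ℕ, m + 1 + 1 - 2 = m from fun m => by omega, Finset.mul_sum]
    exact Finset.sum_congr rfl fun m _ => by ring
  have hsum3 : ∑ j ∈ Finset.range (n + 3 + 1), ((j.choose 3 : ℕ) : PowerSeries ℚ) * w ^ (j - 3) * (0 - θ) ^ 3 =
      -(θ ^ 3 * ∑ m ∈ Finset.range (n + 1), (((m + 3).choose 3 : ℕ) : PowerSeries ℚ) * w ^ m) := by
    rw [Finset.sum_range_succ' (fun j => ((j.choose 3 : ℕ) : PowerSeries ℚ) * w ^ (j - 3) * (0 - θ) ^ 3) (n + 3),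
      Finset.sum_range_succ' (fun j => (((j + 1).choose 3 : ℕ) : PowerSeries ℚ) * w ^ (j + 1 - 3) * (0 - θ) ^ 3) (n + 2),
      Finset.sum_range_succ' (fun j => (((j + 1 + 1).choose 3 : ℕ) : PowerSeries ℚ) * w ^ (j + 1 + 1 - 3) * (0 - θ) ^ 3) (n + 1)]
    simp only [Nat.choose_zero_succ, show Nat.choose 1 3 = 0 by decide, show Nat.choose 2 3 = 0 by decide, Nat.cast_zero,
      zero_mul, add_zero, show ∀ m : ℕ, m + 1 + 1 + 1 - 3 = m from fun m => by omega,
      show ∀ m : ℕ, m + 1 + 1 + 1 = m + 3 from fun m => by omega, Finset.mul_sum]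
    rw [← Finset.sum_neg_distrib]
    exact Finset.sum_congr rfl fun m _ => by ring
  have hMclosed : 6 * ι ^ 4 * M = 6 * (-(Λ * ι ^ 2) + 2 * θ * κ * ι - θ ^ 3) +
      (6 * ι ^ 2 * Λ * (((n + 3 + 1 : ℕ) : PowerSeries ℚ) * w ^ (n + 3) - ((n + 3 : ℕ) : PowerSeries ℚ) * w ^ (n + 3 + 1)) +
        6 * ι * θ * κ * (w ^ (n + 2) * (-(((n + 2 : ℕ) : PowerSeries ℚ) ^ 2 + 3 * ((n + 2 : ℕ) : PowerSeries ℚ) + 2) +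
          (2 * ((n + 2 : ℕ) : PowerSeries ℚ) ^ 2 + 4 * ((n + 2 : ℕ) : PowerSeries ℚ)) * w -
          (((n + 2 : ℕ) : PowerSeries ℚ) ^ 2 + ((n + 2 : ℕ) : PowerSeries ℚ)) * w ^ 2)) -
        θ ^ 3 * (w ^ (n + 1) * (-(((n + 1 : ℕ) : PowerSeries ℚ) ^ 3 + 6 * ((n + 1 : ℕ) : PowerSeries ℚ) ^ 2 +
            11 * ((n + 1 : ℕ) : PowerSeries ℚ) + 6) +
          (3 * ((n + 1 : ℕ) : PowerSeries ℚ) ^ 3 + 15 * ((n + 1 : ℕ) : PowerSeries ℚ) ^ 2 + 18 * ((n + 1 : ℕ) : PowerSeries ℚ)) * w -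
          (3 * ((n + 1 : ℕ) : PowerSeries ℚ) ^ 3 + 12 * ((n + 1 : ℕ) : PowerSeries ℚ) ^ 2 + 9 * ((n + 1 : ℕ) : PowerSeries ℚ)) * w ^ 2 +
          (((n + 1 : ℕ) : PowerSeries ℚ) ^ 3 + 3 * ((n + 1 : ℕ) : PowerSeries ℚ) ^ 2 + 2 * ((n + 1 : ℕ) : PowerSeries ℚ)) * w ^ 3))) := by
    have g2 := alg4_geom2 w (n + 3)
    have g3 := alg4_geom3 w (n + 2)
    have g4 := alg4_geom4 w (n + 1)
    rw [show (1 : PowerSeries ℚ) - w = ι by rw [hw]; ring] at g2 g3 g4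
    rw [hM, Finset.sum_add_distrib, Finset.sum_add_distrib, hsum1, hsum2, hsum3]
    push_cast at g2 g3 g4 ⊢
    linear_combination (-(6 * ι ^ 2 * Λ)) * g2 + (6 * ι * θ * κ) * g3 + (-(θ ^ 3)) * g4
  -- `−Λι² + 2θκι − θ³ = ι⁴ (G₄⁰ + T)` (pure ring), so `6ι⁴(M − G₄⁰ − T)` is a multiple of `Λ w^k`, `θκ w^{k−1}`, `θ³ w^{k−2}`
  have hdiff2 : X ^ (n + 3 + 1) ∣ M - (4 * X ^ 5 * (5 + 14 * X + 52 * X ^ 2 + 40 * X ^ 3) * ι ^ 5 + T) := by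
    apply alg4_dvd_of_dvd_unit_mul 4 6 (by norm_num)
    rw [show PowerSeries.C (6 : ℚ) = 6 from map_ofNat _ 6, ← hι]
    have : 6 * ι ^ 4 * (M - (4 * X ^ 5 * (5 + 14 * X + 52 * X ^ 2 + 40 * X ^ 3) * ι ^ 5 + T)) =
        6 * ι ^ 2 * Λ * (((n + 3 + 1 : ℕ) : PowerSeries ℚ) * w ^ (n + 3) - ((n + 3 : ℕ) : PowerSeries ℚ) * w ^ (n + 3 + 1)) +
        6 * ι * θ * κ * (w ^ (n + 2) * (-(((n + 2 : ℕ) : PowerSeries ℚ) ^ 2 + 3 * ((n + 2 : ℕ) : PowerSeries ℚ) + 2) +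
          (2 * ((n + 2 : ℕ) : PowerSeries ℚ) ^ 2 + 4 * ((n + 2 : ℕ) : PowerSeries ℚ)) * w -
          (((n + 2 : ℕ) : PowerSeries ℚ) ^ 2 + ((n + 2 : ℕ) : PowerSeries ℚ)) * w ^ 2)) -
        θ ^ 3 * (w ^ (n + 1) * (-(((n + 1 : ℕ) : PowerSeries ℚ) ^ 3 + 6 * ((n + 1 : ℕ) : PowerSeries ℚ) ^ 2 +
            11 * ((n + 1 : ℕ) : PowerSeries ℚ) + 6) +
          (3 * ((n + 1 : ℕ) : PowerSeries ℚ) ^ 3 + 15 * ((n + 1 : ℕ) : PowerSeries ℚ) ^ 2 + 18 * ((n + 1 : ℕ) : PowerSeries ℚ)) * w -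
          (3 * ((n + 1 : ℕ) : PowerSeries ℚ) ^ 3 + 12 * ((n + 1 : ℕ) : PowerSeries ℚ) ^ 2 + 9 * ((n + 1 : ℕ) : PowerSeries ℚ)) * w ^ 2 +
          (((n + 1 : ℕ) : PowerSeries ℚ) ^ 3 + 3 * ((n + 1 : ℕ) : PowerSeries ℚ) ^ 2 + 2 * ((n + 1 : ℕ) : PowerSeries ℚ)) * w ^ 3)) := by
      rw [mul_sub, hMclosed, hΛ, hκ, hθ]; ring
    rw [this]
    refine dvd_sub (dvd_add ?_ ?_) ?_
    · -- `Λ · w^{n+3}` has `X^{3 + (n+3)}`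
      have h1 : X ^ (n + 3 + 1) ∣ Λ * w ^ (n + 3) := by
        have h := mul_dvd_mul hΛX (pow_dvd_pow_of_dvd hwX (n + 3))
        rw [← pow_add] at h
        exact (pow_dvd_pow _ (by omega : n + 3 + 1 ≤ 3 + (n + 3))).trans h
      have : 6 * ι ^ 2 * Λ * (((n + 3 + 1 : ℕ) : PowerSeries ℚ) * w ^ (n + 3) - ((n + 3 : ℕ) : PowerSeries ℚ) * w ^ (n + 3 + 1)) =
          Λ * w ^ (n + 3) * (6 * ι ^ 2 * (((n + 3 + 1 : ℕ) : PowerSeries ℚ) - ((n + 3 : ℕ) : PowerSeries ℚ) * w)) := by ring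
      rw [this]
      exact dvd_mul_of_dvd_left h1 _
    · -- `θκ · w^{n+2}` has `X^{5 + (n+2)}`
      have h1 : X ^ (n + 3 + 1) ∣ θ * κ * w ^ (n + 2) := by
        have h := mul_dvd_mul (mul_dvd_mul hθX hκX) (pow_dvd_pow_of_dvd hwX (n + 2))
        rw [← pow_add, ← pow_add] at h
        exact (pow_dvd_pow _ (by omega : n + 3 + 1 ≤ 2 + 3 + (n + 2))).trans h
      have : 6 * ι * θ * κ * (w ^ (n + 2) * (-(((n + 2 : ℕ) : PowerSeries ℚ) ^ 2 + 3 * ((n + 2 : ℕ) : PowerSeries ℚ) + 2) +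
          (2 * ((n + 2 : ℕ) : PowerSeries ℚ) ^ 2 + 4 * ((n + 2 : ℕ) : PowerSeries ℚ)) * w -
          (((n + 2 : ℕ) : PowerSeries ℚ) ^ 2 + ((n + 2 : ℕ) : PowerSeries ℚ)) * w ^ 2)) =
          θ * κ * w ^ (n + 2) * (6 * ι * (-(((n + 2 : ℕ) : PowerSeries ℚ) ^ 2 + 3 * ((n + 2 : ℕ) : PowerSeries ℚ) + 2) +
          (2 * ((n + 2 : ℕ) : PowerSeries ℚ) ^ 2 + 4 * ((n + 2 : ℕ) : PowerSeries ℚ)) * w -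
          (((n + 2 : ℕ) : PowerSeries ℚ) ^ 2 + ((n + 2 : ℕ) : PowerSeries ℚ)) * w ^ 2)) := by ring
      rw [this]
      exact dvd_mul_of_dvd_left h1 _
    · -- `θ³ · w^{n+1}` has `X^{6 + (n+1)}`
      have h1 : X ^ (n + 3 + 1) ∣ θ ^ 3 * w ^ (n + 1) := by
        have h := mul_dvd_mul (pow_dvd_pow_of_dvd hθX 3) (pow_dvd_pow_of_dvd hwX (n + 1))
        rw [← pow_mul, ← pow_add] at h
        exact (pow_dvd_pow _ (by omega : n + 3 + 1 ≤ 2 * 3 + (n + 1))).trans h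
      have : θ ^ 3 * (w ^ (n + 1) * (-(((n + 1 : ℕ) : PowerSeries ℚ) ^ 3 + 6 * ((n + 1 : ℕ) : PowerSeries ℚ) ^ 2 +
            11 * ((n + 1 : ℕ) : PowerSeries ℚ) + 6) +
          (3 * ((n + 1 : ℕ) : PowerSeries ℚ) ^ 3 + 15 * ((n + 1 : ℕ) : PowerSeries ℚ) ^ 2 + 18 * ((n + 1 : ℕ) : PowerSeries ℚ)) * w -
          (3 * ((n + 1 : ℕ) : PowerSeries ℚ) ^ 3 + 12 * ((n + 1 : ℕ) : PowerSeries ℚ) ^ 2 + 9 * ((n + 1 : ℕ) : PowerSeries ℚ)) * w ^ 2 +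
          (((n + 1 : ℕ) : PowerSeries ℚ) ^ 3 + 3 * ((n + 1 : ℕ) : PowerSeries ℚ) ^ 2 + 2 * ((n + 1 : ℕ) : PowerSeries ℚ)) * w ^ 3)) =
          θ ^ 3 * w ^ (n + 1) * (-(((n + 1 : ℕ) : PowerSeries ℚ) ^ 3 + 6 * ((n + 1 : ℕ) : PowerSeries ℚ) ^ 2 +
            11 * ((n + 1 : ℕ) : PowerSeries ℚ) + 6) +
          (3 * ((n + 1 : ℕ) : PowerSeries ℚ) ^ 3 + 15 * ((n + 1 : ℕ) : PowerSeries ℚ) ^ 2 + 18 * ((n + 1 : ℕ) : PowerSeries ℚ)) * w -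
          (3 * ((n + 1 : ℕ) : PowerSeries ℚ) ^ 3 + 12 * ((n + 1 : ℕ) : PowerSeries ℚ) ^ 2 + 9 * ((n + 1 : ℕ) : PowerSeries ℚ)) * w ^ 2 +
          (((n + 1 : ℕ) : PowerSeries ℚ) ^ 3 + 3 * ((n + 1 : ℕ) : PowerSeries ℚ) ^ 2 + 2 * ((n + 1 : ℕ) : PowerSeries ℚ)) * w ^ 3) := by ring
      rw [this]
      exact dvd_mul_of_dvd_left h1 _
  -- combine and read off the coefficient of `X^k`
  have h := dvd_add hdiff1 hdiff2
  rw [sub_add_sub_cancel, ← hQ] at h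
  have hc := (PowerSeries.X_pow_dvd_iff.1 h) (n + 3) (Nat.lt_succ_self _)
  rw [map_sub, sub_eq_zero, Polynomial.coeff_coe] at hc
  rw [hc, hT]


/-- Re-indexing `c = j + 1`: `Σ_{j<k} [a ≤ j] g(j+1) = Σ_{a+1 ≤ c ≤ k} g(c)`. [cite: MadrasSlade1993, §1.1 eq. (1.1.8) p. 5; lane plumbing] -/
private theorem alg4_sum_shift (a : ℕ) (g : ℕ → ℚ) (k : ℕ) :
    ∑ j ∈ Finset.range k, (if a ≤ j then g (j + 1) else 0) = ∑ c ∈ Finset.Icc (a + 1) k, g c := by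
  induction k with
  | zero => rw [Finset.sum_range_zero, Finset.Icc_eq_empty (by omega), Finset.sum_empty]
  | succ k ih =>
    rw [Finset.sum_range_succ, ih]
    by_cases h : a ≤ k
    · rw [if_pos h, Finset.sum_Icc_succ_top (by omega)]
    · rw [if_neg h, add_zero, Finset.Icc_eq_empty (by omega), Finset.Icc_eq_empty (by omega)]

/-- ★ THE PASSENGERS' COEFFICIENTS: `[X^k] T_k = Σ_{3 ≤ c ≤ k} t(c)·C(k,c)·(−2)^{k−c} + Σ_{4 ≤ c ≤ k} s(c)·C(k+1,c+1)·(−2)^{k−c}`, where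
`T_k = Σ_{c ≤ k} X^c (t(c)[c ≥ 3] ι^{c+1} + s(c)[c ≥ 4] ι^{c+2})`, by `[X^m] ι^{r+1} = C(m+r, r)(−2)^m` (`alg4_iota_pow`).
[cite: MadrasSlade1993, §1.1 eq. (1.1.8) p. 5; lane lemma] -/
private theorem alg4_coeff_T (t s : ℕ → ℚ) (k : ℕ) :
    PowerSeries.coeff k (∑ j ∈ Finset.range k, PowerSeries.X ^ (j + 1) * ((if 2 ≤ j then PowerSeries.C (t (j + 1)) else 0) *
          PowerSeries.mk (fun i : ℕ => (-2 : ℚ) ^ i) ^ (j + 2) +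
          (if 3 ≤ j then PowerSeries.C (s (j + 1)) else 0) * PowerSeries.mk (fun i : ℕ => (-2 : ℚ) ^ i) ^ (j + 3))) =
      ∑ c ∈ Finset.Icc 3 k, t c * (k.choose c : ℕ) * (-2 : ℚ) ^ (k - c) +
        ∑ c ∈ Finset.Icc 4 k, s c * ((k + 1).choose (c + 1) : ℕ) * (-2 : ℚ) ^ (k - c) := by
  have hterm : ∀ j ∈ Finset.range k, PowerSeries.coeff k (PowerSeries.X ^ (j + 1) *
      ((if 2 ≤ j then PowerSeries.C (t (j + 1)) else 0) * PowerSeries.mk (fun i : ℕ => (-2 : ℚ) ^ i) ^ (j + 2) +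
        (if 3 ≤ j then PowerSeries.C (s (j + 1)) else 0) * PowerSeries.mk (fun i : ℕ => (-2 : ℚ) ^ i) ^ (j + 3))) =
      (if 2 ≤ j then t (j + 1) * (k.choose (j + 1) : ℕ) * (-2 : ℚ) ^ (k - (j + 1)) else 0) +
        (if 3 ≤ j then s (j + 1) * ((k + 1).choose (j + 1 + 1) : ℕ) * (-2 : ℚ) ^ (k - (j + 1)) else 0) := by
    intro j hj
    rw [Finset.mem_range] at hj
    rw [PowerSeries.coeff_X_pow_mul', if_pos (by omega : j + 1 ≤ k), map_add]
    obtain ⟨m, rfl⟩ : ∃ m, k = m + (j + 1) := ⟨k - (j + 1), by omega⟩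
    rw [Nat.add_sub_cancel]
    congr 1
    · by_cases h2 : 2 ≤ j
      · rw [if_pos h2, if_pos h2, PowerSeries.coeff_C_mul, show j + 2 = (j + 1) + 1 by ring, ← alg4_iota_pow (j + 1),
          PowerSeries.coeff_mk]
        ring
      · rw [if_neg h2, if_neg h2, zero_mul, map_zero]
    · by_cases h3 : 3 ≤ j
      · rw [if_pos h3, if_pos h3, PowerSeries.coeff_C_mul, show j + 3 = (j + 2) + 1 by ring, ← alg4_iota_pow (j + 2),
          PowerSeries.coeff_mk, show m + (j + 1) + 1 = m + (j + 2) by ring, show j + 1 + 1 = j + 2 by ring]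
        ring
      · rw [if_neg h3, if_neg h3, zero_mul, map_zero]
  rw [map_sum, Finset.sum_congr rfl hterm, Finset.sum_add_distrib]
  have e1 := alg4_sum_shift 2 (fun c => t c * (k.choose c : ℕ) * (-2 : ℚ) ^ (k - c)) k
  have e2 := alg4_sum_shift 3 (fun c => s c * ((k + 1).choose (c + 1) : ℕ) * (-2 : ℚ) ^ (k - c)) k
  beta_reduce at e1 e2
  rw [e1, e2]

end Inverse4


/-! ### Part IV — assembly: the quadruples of `[X^i] A_K`, and the response theorem for `[d^{k−3}] c_k^{(d)}` -/

section Assembly4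

/-- A rational polynomial is determined by its values on `ℕ`. [cite: MadrasSlade1993, §1.1 eq. (1.1.8) p. 5; lane plumbing] -/
private theorem alg4_poly_ext {P Q : Polynomial ℚ} (h : ∀ d : ℕ, P.eval (d : ℚ) = Q.eval (d : ℚ)) : P = Q := by
  apply Polynomial.eq_of_infinite_eval_eq
  refine Set.Infinite.mono ?_ (Set.infinite_range_of_injective Nat.cast_injective)
  rintro x ⟨d, rfl⟩
  exact h d

/-- ★★ For every `K` there are symbol polynomials `σ_K ≡ ι`, `τ_K ≡ θ`, `υ_K ≡ κ` and `λ_K ≡ Λ_K = λ₀ − ι² T_K (mod X^{K+1})`,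
`λ₀ = −4X⁵(7+12X+60X²+40X³)ι⁷`, `T_K = Σ_{c ≤ K} X^c (t(c) ι^{c+1} [c ≥ 3] + s(c) ι^{c+2} [c ≥ 4])`, of the family `d ↦ A_K(N(ℤ^{d+1}))`:
the coefficient `[X^i] A_K`, `i ≤ K`, is a polynomial in `d` of degree `≤ i` whose `d^i`-, `d^{i−1}`-, `d^{i−2}`- and `d^{i−3}`-coefficients are
`[X^i]` of `σ_K, τ_K, υ_K, λ_K`. Here `t(c) = [d^{c−3}] count(·, c)` and `s(c) = [d^{c−3}] cost(·, c, c+2)` are the census fourth symbols, taken as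
named inputs (`ht`, `hs`). The first three symbols are those of `exists_symbolTriple_coeff_A` (uniqueness of the polynomial); the fourth is
`alg4_A_step_fourth`. [cite: MadrasSlade1993, §1.1 eq. (1.1.8) p. 5; lane theorem] -/
theorem exists_symbolQuad_coeff_A (t s : ℕ → ℚ)
    (ht : ∀ c : ℕ, 3 ≤ c → ∃ P : Polynomial ℚ, P.natDegree ≤ c ∧ P.coeff (c - 3) = t c ∧ ∀ d : ℕ, (count d c : ℚ) = P.eval (d : ℚ))
    (hs : ∀ c : ℕ, 4 ≤ c → ∃ P : Polynomial ℚ, P.natDegree ≤ c - 2 ∧ P.coeff (c - 3) = s c ∧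
      ∀ d : ℕ, (costCoeffZd d c (c + 2) : ℚ) = P.eval (d : ℚ)) (K : ℕ) :
    ∃ σ τ υ μ : Polynomial ℚ,
    (PowerSeries.X : PowerSeries ℚ) ^ (K + 1) ∣ ((σ : PowerSeries ℚ) - PowerSeries.mk (fun i : ℕ => (-2 : ℚ) ^ i)) ∧
    (PowerSeries.X : PowerSeries ℚ) ^ (K + 1) ∣ ((τ : PowerSeries ℚ) -
      PowerSeries.C (2 : ℚ) * PowerSeries.X ^ 2 * PowerSeries.mk (fun i : ℕ => (-2 : ℚ) ^ i) ^ 3) ∧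
    (PowerSeries.X : PowerSeries ℚ) ^ (K + 1) ∣ ((υ : PowerSeries ℚ) -
      -(PowerSeries.C (2 : ℚ) * PowerSeries.X ^ 3 * (1 - PowerSeries.C (2 : ℚ) * PowerSeries.X + PowerSeries.C (4 : ℚ) * PowerSeries.X ^ 2) *
        PowerSeries.mk (fun i : ℕ => (-2 : ℚ) ^ i) ^ 5)) ∧
    (PowerSeries.X : PowerSeries ℚ) ^ (K + 1) ∣ ((μ : PowerSeries ℚ) -
      ((-(4 * PowerSeries.X ^ 5 * (7 + 12 * PowerSeries.X + 60 * PowerSeries.X ^ 2 + 40 * PowerSeries.X ^ 3) * PowerSeries.mk (fun i : ℕ => (-2 : ℚ) ^ i) ^ 7)) - PowerSeries.mk (fun i : ℕ => (-2 : ℚ) ^ i) ^ 2 *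
        (∑ j ∈ Finset.range K, PowerSeries.X ^ (j + 1) * ((if 2 ≤ j then PowerSeries.C (t (j + 1)) else 0) * PowerSeries.mk (fun i : ℕ => (-2 : ℚ) ^ i) ^ (j + 2) +
        (if 3 ≤ j then PowerSeries.C (s (j + 1)) else 0) * PowerSeries.mk (fun i : ℕ => (-2 : ℚ) ^ i) ^ (j + 3))))) ∧
    ∀ i ≤ K, ∃ P : Polynomial ℚ, P.natDegree ≤ i ∧ P.coeff i = σ.coeff i ∧ (P * Polynomial.X).coeff i = τ.coeff i ∧
      (P * Polynomial.X ^ 2).coeff i = υ.coeff i ∧ (P * Polynomial.X ^ 3).coeff i = μ.coeff i ∧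
      ∀ d : ℕ, (((CostSeries.A (costCoeffZd d) K).coeff i : ℤ) : ℚ) = P.eval (d : ℚ) := by
  induction K with
  | zero =>
    refine ⟨1, 0, 0, 0, ?_, ?_, ?_, ?_, fun i hi => ?_⟩
    · rw [zero_add, PowerSeries.X_pow_dvd_iff]
      intro m hm
      obtain rfl : m = 0 := by omega
      rw [map_sub, Polynomial.coe_one, PowerSeries.coeff_mk, sub_eq_zero, pow_zero]
      exact PowerSeries.coeff_zero_one
    · rw [zero_add, pow_one, Polynomial.coe_zero, zero_sub, dvd_neg]
      exact Dvd.intro (PowerSeries.C (2 : ℚ) * PowerSeries.X * PowerSeries.mk (fun i : ℕ => (-2 : ℚ) ^ i) ^ 3) (by ring)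
    · rw [zero_add, pow_one, Polynomial.coe_zero, zero_sub, dvd_neg, dvd_neg]
      exact Dvd.intro (PowerSeries.C (2 : ℚ) * PowerSeries.X ^ 2 *
        (1 - PowerSeries.C (2 : ℚ) * PowerSeries.X + PowerSeries.C (4 : ℚ) * PowerSeries.X ^ 2) *
        PowerSeries.mk (fun i : ℕ => (-2 : ℚ) ^ i) ^ 5) (by ring)
    · rw [zero_add, pow_one, Polynomial.coe_zero, zero_sub, dvd_neg, Finset.sum_range_zero, mul_zero, sub_zero, dvd_neg]
      exact Dvd.intro (4 * PowerSeries.X ^ 4 * (7 + 12 * PowerSeries.X + 60 * PowerSeries.X ^ 2 + 40 * PowerSeries.X ^ 3) *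
        PowerSeries.mk (fun i : ℕ => (-2 : ℚ) ^ i) ^ 7) (by ring)
    · obtain ⟨P, hP, hPa, hPb, hPc, hPd, h⟩ := symbolQuad_one 0 i hi
      exact ⟨P, hP, hPa, hPb, hPc, hPd, fun d => by rw [← h d, CostSeries.A]⟩
  | succ K ih =>
    obtain ⟨σ, τ, υ, μ, hσ, hτ, hυ, hμ, hA⟩ := ih
    have hstep := symbolQuad_A_succ t s ht hs hA
    have hμ' := alg4_A_step_fourth t s hσ hτ hυ hμ
    obtain ⟨σ', τ', υ', hσ', hτ', hυ', hB⟩ := exists_symbolTriple_coeff_A (K + 1)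
    refine ⟨σ', τ', υ', _, hσ', hτ', hυ', hμ', fun i hi => ?_⟩
    obtain ⟨P, hP, hPa, hPb, hPc, hPd, hev⟩ := hstep i hi
    obtain ⟨Q, -, hQa, hQb, hQc, hQev⟩ := hB i hi
    have hPQ : P = Q := alg4_poly_ext fun d => by rw [← hev d, hQev d]
    exact ⟨P, hP, by rw [hPQ, hQa], by rw [hPQ, hQb], by rw [hPQ, hQc], hPd, hev⟩

/-- ★★ THE THIRD COEFFICIENT OF `c_k^{(d)}` IN THE DIMENSION, SERIES FORM: for every `k ≥ 3`, `d ↦ c_k^{(d)} = largeForceCoeffZd d k` is a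
polynomial over `ℚ` of degree EXACTLY `k − 1`, with the top two coefficients of `SAWPulledLargeForceExpansionZdThirdSymbol` and
`[d^{k−3}] c_k^{(d)} = [X^k] (4X⁵(5 + 14X + 52X² + 40X³)ι⁵ + T_k)`, `ι = (1+2X)⁻¹`, `T_k = Σ_{c ≤ k} X^c (t(c)[c ≥ 3] ι^{c+1} + s(c)[c ≥ 4] ι^{c+2})`,
where `t(c) = [d^{c−3}] c_c(ℤ^d)` and `s(c) = [d^{c−3}] N_{c,c+2}(ℤ^{d+1})` are the census fourth symbols, NAMED by the hypotheses `ht`, `hs` (which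
hold for the unique values and assume no law). Proof: `c_k^{(d)} = [X^k] E_k`; the fourth symbol of `E_k` is `alg4_E`, fed by the fixed point
`exists_symbolQuad_coeff_A`. [cite: MadrasSlade1993, §1.1 eq. (1.1.8) p. 5; §4.2 eq. (4.2.20)–(4.2.22); lane theorem] -/
theorem exists_polynomial_largeForceCoeffZd_thirdCoeff_series (t s : ℕ → ℚ)
    (ht : ∀ c : ℕ, 3 ≤ c → ∃ P : Polynomial ℚ, P.natDegree ≤ c ∧ P.coeff (c - 3) = t c ∧ ∀ d : ℕ, (count d c : ℚ) = P.eval (d : ℚ))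
    (hs : ∀ c : ℕ, 4 ≤ c → ∃ P : Polynomial ℚ, P.natDegree ≤ c - 2 ∧ P.coeff (c - 3) = s c ∧
      ∀ d : ℕ, (costCoeffZd d c (c + 2) : ℚ) = P.eval (d : ℚ)) {k : ℕ} (hk : 3 ≤ k) :
    ∃ P : Polynomial ℚ, P.natDegree = k - 1 ∧ P.leadingCoeff = (-2 : ℚ) ^ (k - 1) ∧
      P.coeff (k - 2) = (-1 : ℚ) ^ (k - 1) * 2 ^ (k - 2) * ((k : ℚ) ^ 2 - 5 * k + 7) ∧
      P.coeff (k - 3) = PowerSeries.coeff k (PowerSeries.C (4 : ℚ) * PowerSeries.X ^ 5 *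
        (PowerSeries.C (5 : ℚ) + PowerSeries.C (14 : ℚ) * PowerSeries.X + PowerSeries.C (52 : ℚ) * PowerSeries.X ^ 2 +
          PowerSeries.C (40 : ℚ) * PowerSeries.X ^ 3) * PowerSeries.mk (fun i : ℕ => (-2 : ℚ) ^ i) ^ 5 +
        ∑ j ∈ Finset.range k, PowerSeries.X ^ (j + 1) * ((if 2 ≤ j then PowerSeries.C (t (j + 1)) else 0) *
          PowerSeries.mk (fun i : ℕ => (-2 : ℚ) ^ i) ^ (j + 2) +
          (if 3 ≤ j then PowerSeries.C (s (j + 1)) else 0) * PowerSeries.mk (fun i : ℕ => (-2 : ℚ) ^ i) ^ (j + 3))) ∧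
      ∀ d : ℕ, (largeForceCoeffZd d k : ℚ) = P.eval (d : ℚ) := by
  obtain ⟨σ, τ, υ, μ, hσ, hτ, hυ, hμ, hA⟩ := exists_symbolQuad_coeff_A t s ht hs k
  -- the family `1 − A_k` has symbol quadruple `(1 − σ, −τ, −υ, −μ)`; its powers and their sum
  have h1 : ∀ i ≤ k, ∃ P : Polynomial ℚ, P.natDegree ≤ i ∧ P.coeff i = (1 - σ).coeff i ∧
      (P * Polynomial.X).coeff i = (0 - τ).coeff i ∧ (P * Polynomial.X ^ 2).coeff i = (0 - υ).coeff i ∧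
      (P * Polynomial.X ^ 3).coeff i = (0 - μ).coeff i ∧
      ∀ d : ℕ, (((1 - CostSeries.A (costCoeffZd d) k).coeff i : ℤ) : ℚ) = P.eval (d : ℚ) :=
    symbolQuad_sub (S := fun _ => (1 : Polynomial ℤ)) (symbolQuad_one k) hA
  have hE : ∀ i ≤ k, ∃ P : Polynomial ℚ, P.natDegree ≤ i ∧
      P.coeff i = (∑ j ∈ Finset.range (k + 1), (1 - σ) ^ j).coeff i ∧
      (P * Polynomial.X).coeff i = (∑ j ∈ Finset.range (k + 1), (j : Polynomial ℚ) * (1 - σ) ^ (j - 1) * (0 - τ)).coeff i ∧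
      (P * Polynomial.X ^ 2).coeff i = (∑ j ∈ Finset.range (k + 1), ((j : Polynomial ℚ) * (1 - σ) ^ (j - 1) * (0 - υ) +
        ((j.choose 2 : ℕ) : Polynomial ℚ) * (1 - σ) ^ (j - 2) * (0 - τ) ^ 2)).coeff i ∧
      (P * Polynomial.X ^ 3).coeff i = (∑ j ∈ Finset.range (k + 1), ((j : Polynomial ℚ) * (1 - σ) ^ (j - 1) * (0 - μ) +
        2 * ((j.choose 2 : ℕ) : Polynomial ℚ) * (1 - σ) ^ (j - 2) * (0 - τ) * (0 - υ) +
        ((j.choose 3 : ℕ) : Polynomial ℚ) * (1 - σ) ^ (j - 3) * (0 - τ) ^ 3)).coeff i ∧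
      ∀ d : ℕ, (((∑ j ∈ Finset.range (k + 1), (1 - CostSeries.A (costCoeffZd d) k) ^ j).coeff i : ℤ) : ℚ) = P.eval (d : ℚ) :=
    symbolQuad_sum (Finset.range (k + 1)) (S := fun j d => (1 - CostSeries.A (costCoeffZd d) k) ^ j) (σ := fun j => (1 - σ) ^ j)
      (τ := fun j => (j : Polynomial ℚ) * (1 - σ) ^ (j - 1) * (0 - τ))
      (υ := fun j => (j : Polynomial ℚ) * (1 - σ) ^ (j - 1) * (0 - υ) + ((j.choose 2 : ℕ) : Polynomial ℚ) * (1 - σ) ^ (j - 2) * (0 - τ) ^ 2)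
      (μ := fun j => (j : Polynomial ℚ) * (1 - σ) ^ (j - 1) * (0 - μ) +
        2 * ((j.choose 2 : ℕ) : Polynomial ℚ) * (1 - σ) ^ (j - 2) * (0 - τ) * (0 - υ) +
        ((j.choose 3 : ℕ) : Polynomial ℚ) * (1 - σ) ^ (j - 3) * (0 - τ) ^ 3)
      (fun j _ => symbolQuad_pow (S := fun d => 1 - CostSeries.A (costCoeffZd d) k) h1 j)
  obtain ⟨P, -, -, -, -, hPd, h⟩ := hE k le_rfl
  have hev : ∀ d : ℕ, (largeForceCoeffZd d k : ℚ) = P.eval (d : ℚ) := fun d => by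
    rw [← h d, largeForceCoeffZd, CostSeries.e, CostSeries.E]
  -- the fourth coefficient
  have hfourth := hPd.trans (alg4_E t s hk hσ hτ hυ hμ)
  -- degree and the top two coefficients from the third-symbol file, by uniqueness of the polynomial
  obtain ⟨Q, hQdeg, hQlead, hQsec, hQev⟩ := exists_polynomial_largeForceCoeffZd_secondCoeff hk
  have hPQ : P = Q := alg4_poly_ext fun d => by rw [← hev d, hQev d]
  refine ⟨Q, hQdeg, hQlead, hQsec, ?_, hQev⟩
  obtain ⟨m, rfl⟩ : ∃ m, k = m + 3 := ⟨k - 3, by omega⟩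
  rw [Nat.add_sub_cancel, ← Polynomial.coeff_mul_X_pow Q 3 m, ← hPQ, hfourth]

/-- ★★★ THE THIRD COEFFICIENT OF `c_k^{(d)}` IN THE DIMENSION — THE RESPONSE THEOREM: for every `k ≥ 4`, `d ↦ c_k^{(d)}` is a polynomial of degree
`k − 1` with `[d^{k−1}] = (−2)^{k−1}`, `[d^{k−2}] = (−1)^{k−1}2^{k−2}(k² − 5k + 7)` and
`[d^{k−3}] c_k^{(d)} = (−2)^k (−3k⁴ + 38k³ − 165k² + 214k + 120)/96 + Σ_{3 ≤ c ≤ k} t(c)·C(k,c)·(−2)^{k−c} + Σ_{4 ≤ c ≤ k} s(c)·C(k+1,c+1)·(−2)^{k−c}`,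
the response of the fourth 1/d-symbol of `c_k^{(d)}` to the two census fourth symbols `t(c) = [d^{c−3}] c_c(ℤ^d)` (`c ≥ 3`) and
`s(c) = [d^{c−3}] N_{c,c+2}(ℤ^{d+1})` (`c ≥ 4`); the first summand is `[X^k] 4X⁵(5+14X+52X²+40X³)(1+2X)⁻⁵` (`alg4_coeff_G`), the kernels are
`[X^{k−c}](1+2X)^{−c−1} = C(k,c)(−2)^{k−c}` and `[X^{k−c}](1+2X)^{−c−2} = C(k+1,c+1)(−2)^{k−c}` (`alg4_coeff_T`). With the lane's laws for `t`, `s`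
(FINDING-ZD-FOURTH-SYMBOL, NOT assumed here) the right-hand side is Am. BC's `(−1)^{k−1}2^{k−3}(k−3)(k−4)(5k²−35k+56)/12`. (`k = 3`: the series
form gives `[d⁰] c₃^{(d)} = t(3)`.) [cite: MadrasSlade1993, §1.1 eq. (1.1.8) p. 5; §4.2 eq. (4.2.20)–(4.2.22)] [cite: ClisbyLiangSlade2007, §1.3 eq. (1)/(3); lane theorem] -/
theorem exists_polynomial_largeForceCoeffZd_thirdCoeff (t s : ℕ → ℚ)
    (ht : ∀ c : ℕ, 3 ≤ c → ∃ P : Polynomial ℚ, P.natDegree ≤ c ∧ P.coeff (c - 3) = t c ∧ ∀ d : ℕ, (count d c : ℚ) = P.eval (d : ℚ))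
    (hs : ∀ c : ℕ, 4 ≤ c → ∃ P : Polynomial ℚ, P.natDegree ≤ c - 2 ∧ P.coeff (c - 3) = s c ∧
      ∀ d : ℕ, (costCoeffZd d c (c + 2) : ℚ) = P.eval (d : ℚ)) {k : ℕ} (hk : 4 ≤ k) :
    ∃ P : Polynomial ℚ, P.natDegree = k - 1 ∧ P.leadingCoeff = (-2 : ℚ) ^ (k - 1) ∧
      P.coeff (k - 2) = (-1 : ℚ) ^ (k - 1) * 2 ^ (k - 2) * ((k : ℚ) ^ 2 - 5 * k + 7) ∧
      P.coeff (k - 3) = (-2 : ℚ) ^ k * (-3 * (k : ℚ) ^ 4 + 38 * (k : ℚ) ^ 3 - 165 * (k : ℚ) ^ 2 + 214 * (k : ℚ) + 120) / 96 +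
        ∑ c ∈ Finset.Icc 3 k, t c * (k.choose c : ℕ) * (-2 : ℚ) ^ (k - c) +
        ∑ c ∈ Finset.Icc 4 k, s c * ((k + 1).choose (c + 1) : ℕ) * (-2 : ℚ) ^ (k - c) ∧
      ∀ d : ℕ, (largeForceCoeffZd d k : ℚ) = P.eval (d : ℚ) := by
  obtain ⟨P, hdeg, hlead, hsec, hthird, hev⟩ := exists_polynomial_largeForceCoeffZd_thirdCoeff_series t s ht hs (by omega : 3 ≤ k)
  refine ⟨P, hdeg, hlead, hsec, ?_, hev⟩
  rw [hthird, map_add, alg4_coeff_G hk, alg4_coeff_T]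
  ring

/-- ★★★ The same with the degree BOUND only (the form consumed by the symbol calculus one order up): for `k ≥ 4`, `deg ≤ k − 1`,
`[X^{k−1}] = (−2)^{k−1}`, `[X^{k−2}] = (−1)^{k−1}2^{k−2}(k²−5k+7)`, `[X^{k−3}] =` the response of `exists_polynomial_largeForceCoeffZd_thirdCoeff`.
[cite: MadrasSlade1993, §1.1 eq. (1.1.8) p. 5; lane theorem] -/
theorem exists_polynomial_largeForceCoeffZd_topFour (t s : ℕ → ℚ)
    (ht : ∀ c : ℕ, 3 ≤ c → ∃ P : Polynomial ℚ, P.natDegree ≤ c ∧ P.coeff (c - 3) = t c ∧ ∀ d : ℕ, (count d c : ℚ) = P.eval (d : ℚ))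
    (hs : ∀ c : ℕ, 4 ≤ c → ∃ P : Polynomial ℚ, P.natDegree ≤ c - 2 ∧ P.coeff (c - 3) = s c ∧
      ∀ d : ℕ, (costCoeffZd d c (c + 2) : ℚ) = P.eval (d : ℚ)) {k : ℕ} (hk : 4 ≤ k) :
    ∃ P : Polynomial ℚ, P.natDegree ≤ k - 1 ∧ P.coeff (k - 1) = (-2 : ℚ) ^ (k - 1) ∧
      P.coeff (k - 2) = (-1 : ℚ) ^ (k - 1) * 2 ^ (k - 2) * ((k : ℚ) ^ 2 - 5 * k + 7) ∧
      P.coeff (k - 3) = (-2 : ℚ) ^ k * (-3 * (k : ℚ) ^ 4 + 38 * (k : ℚ) ^ 3 - 165 * (k : ℚ) ^ 2 + 214 * (k : ℚ) + 120) / 96 +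
        ∑ c ∈ Finset.Icc 3 k, t c * (k.choose c : ℕ) * (-2 : ℚ) ^ (k - c) +
        ∑ c ∈ Finset.Icc 4 k, s c * ((k + 1).choose (c + 1) : ℕ) * (-2 : ℚ) ^ (k - c) ∧
      ∀ d : ℕ, (largeForceCoeffZd d k : ℚ) = P.eval (d : ℚ) := by
  obtain ⟨P, hdeg, hlead, hsec, hthird, hev⟩ := exists_polynomial_largeForceCoeffZd_thirdCoeff t s ht hs hk
  refine ⟨P, hdeg.le, ?_, hsec, hthird, hev⟩
  rw [Polynomial.leadingCoeff, hdeg] at hlead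
  exact hlead

end Assembly4


/-! ### Part V — the COLLAPSE under the two census laws: Am. BC's fourth-symbol law -/

section Collapse

/-- Telescoping for the cubic law: `(1 − w)⁴ Σ_{j<k} w^{j+1} p(j+1) = B_p(w) − w^{k+1} R_p(k, w)`, `p(c) = c³ − 12c² + 59c − 138`
(`p(j+1) = j³ − 9j² + 38j − 90`), `B_p = −90w + 300w² − 342w³ + 138w⁴`. [cite: MadrasSlade1993, §1.1 eq. (1.1.8) p. 5; lane plumbing] -/
private theorem alg5_tele_p (w i : PowerSeries ℚ) (hi : i = 1 - w) (k : ℕ) :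
    i ^ 4 * ∑ j ∈ Finset.range k, w ^ (j + 1) * ((j : PowerSeries ℚ) ^ 3 - 9 * (j : PowerSeries ℚ) ^ 2 + 38 * (j : PowerSeries ℚ) - 90) =
      (138 * w ^ 4 - 342 * w ^ 3 + 300 * w ^ 2 - 90 * w) - w ^ (k + 1) *
        (-(k : PowerSeries ℚ) ^ 3 * w ^ 3 + 12 * (k : PowerSeries ℚ) ^ 2 * w ^ 3 + 3 * (k : PowerSeries ℚ) ^ 3 * w ^ 2 - 59 * (k : PowerSeries ℚ) * w ^ 3 - 33 * (k : PowerSeries ℚ) ^ 2 * w ^ 2 - 3 * (k : PowerSeries ℚ) ^ 3 * w + 150 * (k : PowerSeries ℚ) * w ^ 2 + 30 * (k : PowerSeries ℚ) ^ 2 * w + (k : PowerSeries ℚ) ^ 3 + 138 * w ^ 3 - 129 * (k : PowerSeries ℚ) * w - 9 * (k : PowerSeries ℚ) ^ 2 - 342 * w ^ 2 + 38 * (k : PowerSeries ℚ) + 300 * w - 90) := by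
  subst hi
  induction k with
  | zero => rw [Finset.sum_range_zero]; push_cast; ring
  | succ k ih => rw [Finset.sum_range_succ, mul_add, ih]; push_cast; ring

/-- Telescoping for the quartic law: `(1 − w)⁵ Σ_{j<k} w^{j+1} q(j+1) = B_q(w) − w^{k+1} R_q(k, w)`, `q(c) = c⁴ − 12c³ + 65c² − 180c + 198`
(`q(j+1) = j⁴ − 8j³ + 35j² − 82j + 72`), `B_q = 72w − 342w² + 630w³ − 534w⁴ + 198w⁵`. [cite: MadrasSlade1993, §1.1 eq. (1.1.8) p. 5; lane plumbing] -/
private theorem alg5_tele_q (w i : PowerSeries ℚ) (hi : i = 1 - w) (k : ℕ) :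
    i ^ 5 * ∑ j ∈ Finset.range k, w ^ (j + 1) *
      ((j : PowerSeries ℚ) ^ 4 - 8 * (j : PowerSeries ℚ) ^ 3 + 35 * (j : PowerSeries ℚ) ^ 2 - 82 * (j : PowerSeries ℚ) + 72) =
      (198 * w ^ 5 - 534 * w ^ 4 + 630 * w ^ 3 - 342 * w ^ 2 + 72 * w) - w ^ (k + 1) *
        ((k : PowerSeries ℚ) ^ 4 * w ^ 4 - 12 * (k : PowerSeries ℚ) ^ 3 * w ^ 4 - 4 * (k : PowerSeries ℚ) ^ 4 * w ^ 3 + 65 * (k : PowerSeries ℚ) ^ 2 * w ^ 4 + 44 * (k : PowerSeries ℚ) ^ 3 * w ^ 3 + 6 * (k : PowerSeries ℚ) ^ 4 * w ^ 2 - 180 * (k : PowerSeries ℚ) * w ^ 4 - 218 * (k : PowerSeries ℚ) ^ 2 * w ^ 3 - 60 * (k : PowerSeries ℚ) ^ 3 * w ^ 2 - 4 * (k : PowerSeries ℚ) ^ 4 * w + 550 * (k : PowerSeries ℚ) * w ^ 3 + 276 * (k : PowerSeries ℚ) ^ 2 * w ^ 2 + 36 * (k : PowerSeries ℚ) ^ 3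 * w + (k : PowerSeries ℚ) ^ 4 + 198 * w ^ 4 - 666 * (k : PowerSeries ℚ) * w ^ 2 - 158 * (k : PowerSeries ℚ) ^ 2 * w - 8 * (k : PowerSeries ℚ) ^ 3 - 534 * w ^ 3 + 378 * (k : PowerSeries ℚ) * w + 35 * (k : PowerSeries ℚ) ^ 2 + 630 * w ^ 2 - 82 * (k : PowerSeries ℚ) - 342 * w + 72) := by
  subst hi
  induction k with
  | zero => rw [Finset.sum_range_zero]; push_cast; ring
  | succ k ih => rw [Finset.sum_range_succ, mul_add, ih]; push_cast; ring

/-- ★ The passengers UNDER THE CENSUS LAWS, term by term: `48·X^{j+1}(t₄(j)ι^{j+2} + s₄(j)ι^{j+3}) = −(2X)^{j+1}ι^{j+2}(p(j+1) + ι q(j+1)) + corr_j`,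
where the uniform law value is corrected on the four exceptional cells `j ≤ 3` (`t(1), t(2)` absent, `t(3) = 0`, `t(4) = 2` instead of the cubic
law's `15/4, 5, 7, 10`; `s(1), s(2), s(3)` absent instead of `−3, −3/2, 0`). [cite: MadrasSlade1993, §1.1 eq. (1.1.8) p. 5; lane lemma] -/
private theorem alg5_term (t s : ℕ → ℚ) (ht3 : t 3 = 0) (ht4 : t 4 = 2)
    (ht : ∀ c : ℕ, 5 ≤ c → 48 * t c = -(2 : ℚ) ^ c * ((c : ℚ) ^ 3 - 12 * (c : ℚ) ^ 2 + 59 * (c : ℚ) - 138))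
    (hs : ∀ c : ℕ, 4 ≤ c → 48 * s c = -(2 : ℚ) ^ c * ((c : ℚ) ^ 4 - 12 * (c : ℚ) ^ 3 + 65 * (c : ℚ) ^ 2 - 180 * (c : ℚ) + 198))
    (j : ℕ) (X ι : PowerSeries ℚ) :
    48 * (X ^ (j + 1) * ((if 2 ≤ j then PowerSeries.C (t (j + 1)) else 0) * ι ^ (j + 2) +
      (if 3 ≤ j then PowerSeries.C (s (j + 1)) else 0) * ι ^ (j + 3))) =
    -((2 * X) ^ (j + 1) * ι ^ (j + 2) * (((j : PowerSeries ℚ) ^ 3 - 9 * (j : PowerSeries ℚ) ^ 2 + 38 * (j : PowerSeries ℚ) - 90) +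
      ι * ((j : PowerSeries ℚ) ^ 4 - 8 * (j : PowerSeries ℚ) ^ 3 + 35 * (j : PowerSeries ℚ) ^ 2 - 82 * (j : PowerSeries ℚ) + 72))) +
    (if j = 0 then -180 * X * ι ^ 2 + 144 * X * ι ^ 3 else if j = 1 then -240 * X ^ 2 * ι ^ 3 + 72 * X ^ 2 * ι ^ 4
      else if j = 2 then -336 * X ^ 3 * ι ^ 4 else if j = 3 then -384 * X ^ 4 * ι ^ 5 else 0) := by
  have h48 : (48 : PowerSeries ℚ) = PowerSeries.C (48 : ℚ) := (map_ofNat _ 48).symm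
  rcases j with _ | _ | _ | _ | m
  · simp only [show ¬ (2 ≤ 0) by omega, show ¬ (3 ≤ 0) by omega, if_false, if_true]
    push_cast; ring
  · simp only [show ¬ (2 ≤ 1) by omega, show ¬ (3 ≤ 1) by omega, show (1 : ℕ) ≠ 0 by omega, if_false, if_true]
    push_cast; ring
  · simp only [show (2 : ℕ) ≤ 2 by omega, show ¬ (3 ≤ 2) by omega, show (2 : ℕ) ≠ 0 by omega, show (2 : ℕ) ≠ 1 by omega,
      if_false, if_true, ht3, map_zero]
    push_cast; ring
  · have e2 : (48 : PowerSeries ℚ) * PowerSeries.C (s 4) = -(2 : PowerSeries ℚ) ^ 4 *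
        (((4 : ℕ) : PowerSeries ℚ) ^ 4 - 12 * ((4 : ℕ) : PowerSeries ℚ) ^ 3 + 65 * ((4 : ℕ) : PowerSeries ℚ) ^ 2 -
          180 * ((4 : ℕ) : PowerSeries ℚ) + 198) := by
      rw [h48, ← map_mul, hs 4 (by omega)]
      simp only [map_neg, map_mul, map_pow, map_sub, map_add, map_natCast, map_ofNat]
    simp only [show (2 : ℕ) ≤ 3 by omega, show (3 : ℕ) ≤ 3 by omega, show (3 : ℕ) ≠ 0 by omega, show (3 : ℕ) ≠ 1 by omega,
      show (3 : ℕ) ≠ 2 by omega, if_false, if_true, ht4, map_ofNat]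
    push_cast at e2 ⊢
    linear_combination (X ^ 4 * ι ^ 6) * e2
  · have e1 : (48 : PowerSeries ℚ) * PowerSeries.C (t (m + 4 + 1)) = -(2 : PowerSeries ℚ) ^ (m + 4 + 1) *
        (((m + 4 + 1 : ℕ) : PowerSeries ℚ) ^ 3 - 12 * ((m + 4 + 1 : ℕ) : PowerSeries ℚ) ^ 2 + 59 * ((m + 4 + 1 : ℕ) : PowerSeries ℚ) - 138) := by
      rw [h48, ← map_mul, ht (m + 4 + 1) (by omega)]
      simp only [map_neg, map_mul, map_pow, map_sub, map_add, map_natCast, map_ofNat]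
    have e2 : (48 : PowerSeries ℚ) * PowerSeries.C (s (m + 4 + 1)) = -(2 : PowerSeries ℚ) ^ (m + 4 + 1) *
        (((m + 4 + 1 : ℕ) : PowerSeries ℚ) ^ 4 - 12 * ((m + 4 + 1 : ℕ) : PowerSeries ℚ) ^ 3 + 65 * ((m + 4 + 1 : ℕ) : PowerSeries ℚ) ^ 2 -
          180 * ((m + 4 + 1 : ℕ) : PowerSeries ℚ) + 198) := by
      rw [h48, ← map_mul, hs (m + 4 + 1) (by omega)]
      simp only [map_neg, map_mul, map_pow, map_sub, map_add, map_natCast, map_ofNat]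
    rw [if_pos (by omega : 2 ≤ m + 4), if_pos (by omega : 3 ≤ m + 4), if_neg (by omega : m + 4 ≠ 0), if_neg (by omega : m + 4 ≠ 1),
      if_neg (by omega : m + 4 ≠ 2), if_neg (by omega : m + 4 ≠ 3)]
    push_cast at e1 e2 ⊢
    linear_combination (X ^ (m + 4 + 1) * ι ^ (m + 4 + 2)) * e1 + (X ^ (m + 4 + 1) * ι ^ (m + 4 + 3)) * e2

/-- ★ The CLOSING IDENTITY of the collapse: `−ι²(B_p(w) + B_q(w)) + ι⁵ D + 384X⁵(2 + 15X + 24X² + 20X³)ι¹⁰ = 0`, `w = 2Xι`, where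
`D = −180Xι² + 144Xι³ − 240X²ι³ + 72X²ι⁴ − 336X³ι⁴ − 384X⁴ι⁵` collects the four corrections (24-term certificate against `(1+2X)ι = 1`).
[cite: MadrasSlade1993, §1.1 eq. (1.1.8) p. 5; lane lemma] -/
private theorem alg5_close (X ι : PowerSeries ℚ) (hF1 : (1 + 2 * X) * ι = 1) :
    -(ι ^ 2 * ((138 * (2 * X * ι) ^ 4 - 342 * (2 * X * ι) ^ 3 + 300 * (2 * X * ι) ^ 2 - 90 * (2 * X * ι)) +
        (198 * (2 * X * ι) ^ 5 - 534 * (2 * X * ι) ^ 4 + 630 * (2 * X * ι) ^ 3 - 342 * (2 * X * ι) ^ 2 + 72 * (2 * X * ι)))) +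
      ι ^ 5 * (-180 * X * ι ^ 2 + 144 * X * ι ^ 3 - 240 * X ^ 2 * ι ^ 3 + 72 * X ^ 2 * ι ^ 4 - 336 * X ^ 3 * ι ^ 4 - 384 * X ^ 4 * ι ^ 5) +
      384 * X ^ 5 * (2 + 15 * X + 24 * X ^ 2 + 20 * X ^ 3) * ι ^ 10 = 0 := by
  linear_combination (3840 * X ^ 7 * ι ^ 9 + 2688 * X ^ 6 * ι ^ 9 + 1536 * X ^ 5 * ι ^ 9 + 1920 * X ^ 6 * ι ^ 8 - 384 * X ^ 4 * ι ^ 9 + 384 * X ^ 5 * ι ^ 8 + 576 * X ^ 4 * ι ^ 8 + 960 * X ^ 5 * ι ^ 7 - 480 * X ^ 3 * ι ^ 8 - 288 * X ^ 4 * ι ^ 7 + 72 * X ^ 2 * ι ^ 8 + 432 * X ^ 3 * ι ^ 7 - 2688 * X ^ 4 * ι ^ 6 - 456 * X ^ 2 * ι ^ 7 + 1200 * X ^ 3 * ι ^ 6 + 144 * X * ι ^ 7 - 384 * X ^ 2 * ι ^ 6 + 1824 * X ^ 3 * ι ^ 5 - 36 * X * ι ^ 6 - 312 * X ^ 2 *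 ι ^ 5 - 36 * X * ι ^ 5 - 240 * X ^ 2 * ι ^ 4 - 36 * X * ι ^ 4 - 36 * X * ι ^ 3) * hF1

/-- ★★ THE PASSENGERS COLLAPSE: under the census laws, `T_k ≡ −8X⁵(2 + 15X + 24X² + 20X³)ι⁵ (mod X^{k+1})` for every `k ≥ 3` — the sum of
the law terms telescopes (`alg5_tele_p/q`), the four exceptional cells and the boundary polynomials cancel against the closed form by
`alg5_close`, and the remainders carry `w^{k+1}`. [cite: MadrasSlade1993, §1.1 eq. (1.1.8) p. 5; lane lemma] -/
private theorem alg5_T_law (t s : ℕ → ℚ) (ht3 : t 3 = 0) (ht4 : t 4 = 2)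
    (ht : ∀ c : ℕ, 5 ≤ c → 48 * t c = -(2 : ℚ) ^ c * ((c : ℚ) ^ 3 - 12 * (c : ℚ) ^ 2 + 59 * (c : ℚ) - 138))
    (hs : ∀ c : ℕ, 4 ≤ c → 48 * s c = -(2 : ℚ) ^ c * ((c : ℚ) ^ 4 - 12 * (c : ℚ) ^ 3 + 65 * (c : ℚ) ^ 2 - 180 * (c : ℚ) + 198))
    {k : ℕ} (hk : 3 ≤ k) :
    (PowerSeries.X : PowerSeries ℚ) ^ (k + 1) ∣
      (∑ j ∈ Finset.range k, PowerSeries.X ^ (j + 1) * ((if 2 ≤ j then PowerSeries.C (t (j + 1)) else 0) *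
          PowerSeries.mk (fun i : ℕ => (-2 : ℚ) ^ i) ^ (j + 2) +
          (if 3 ≤ j then PowerSeries.C (s (j + 1)) else 0) * PowerSeries.mk (fun i : ℕ => (-2 : ℚ) ^ i) ^ (j + 3))) +
      8 * PowerSeries.X ^ 5 * (2 + 15 * PowerSeries.X + 24 * PowerSeries.X ^ 2 + 20 * PowerSeries.X ^ 3) *
        PowerSeries.mk (fun i : ℕ => (-2 : ℚ) ^ i) ^ 5 := by
  set ι : PowerSeries ℚ := PowerSeries.mk (fun i : ℕ => (-2 : ℚ) ^ i) with hι
  have hF1' : (1 + PowerSeries.C (2 : ℚ) * PowerSeries.X) * ι = 1 := alg4_iota_mul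
  have hC2 : PowerSeries.C (2 : ℚ) = 2 := map_ofNat _ 2
  have hF1 : (1 + 2 * PowerSeries.X) * ι = 1 := by rw [← hC2]; exact hF1'
  set X : PowerSeries ℚ := PowerSeries.X with hX
  set w : PowerSeries ℚ := 1 - ι with hw
  have hw2 : 2 * X * ι = w := by rw [hw]; linear_combination hF1
  have hwX : X ∣ w := by rw [← hw2]; exact Dvd.intro_left 2 (by ring) |>.mul_right ι
  set T : PowerSeries ℚ := ∑ j ∈ Finset.range k, X ^ (j + 1) * ((if 2 ≤ j then PowerSeries.C (t (j + 1)) else 0) * ι ^ (j + 2) +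
    (if 3 ≤ j then PowerSeries.C (s (j + 1)) else 0) * ι ^ (j + 3)) with hT
  -- `48 T = −(ι Σ w^{j+1} p + ι² Σ w^{j+1} q) + Σ corr`
  have h48T : 48 * T = -(ι * ∑ j ∈ Finset.range k, w ^ (j + 1) * ((j : PowerSeries ℚ) ^ 3 - 9 * (j : PowerSeries ℚ) ^ 2 + 38 * (j : PowerSeries ℚ) - 90) +
      ι ^ 2 * ∑ j ∈ Finset.range k, w ^ (j + 1) *
        ((j : PowerSeries ℚ) ^ 4 - 8 * (j : PowerSeries ℚ) ^ 3 + 35 * (j : PowerSeries ℚ) ^ 2 - 82 * (j : PowerSeries ℚ) + 72)) +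
      ∑ j ∈ Finset.range k, (if j = 0 then -180 * X * ι ^ 2 + 144 * X * ι ^ 3 else if j = 1 then -240 * X ^ 2 * ι ^ 3 + 72 * X ^ 2 * ι ^ 4
        else if j = 2 then -336 * X ^ 3 * ι ^ 4 else if j = 3 then -384 * X ^ 4 * ι ^ 5 else 0) := by
    have hmodel : ∀ j : ℕ, -((2 * X) ^ (j + 1) * ι ^ (j + 2) * (((j : PowerSeries ℚ) ^ 3 - 9 * (j : PowerSeries ℚ) ^ 2 + 38 * (j : PowerSeries ℚ) - 90) +
        ι * ((j : PowerSeries ℚ) ^ 4 - 8 * (j : PowerSeries ℚ) ^ 3 + 35 * (j : PowerSeries ℚ) ^ 2 - 82 * (j : PowerSeries ℚ) + 72))) =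
        -(ι * (w ^ (j + 1) * ((j : PowerSeries ℚ) ^ 3 - 9 * (j : PowerSeries ℚ) ^ 2 + 38 * (j : PowerSeries ℚ) - 90)) +
          ι ^ 2 * (w ^ (j + 1) * ((j : PowerSeries ℚ) ^ 4 - 8 * (j : PowerSeries ℚ) ^ 3 + 35 * (j : PowerSeries ℚ) ^ 2 - 82 * (j : PowerSeries ℚ) + 72))) :=
      fun j => by rw [← hw2]; ring
    rw [hT, Finset.mul_sum, Finset.sum_congr rfl (fun j _ => alg5_term t s ht3 ht4 ht hs j X ι)]
    simp only [hmodel]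
    rw [Finset.sum_add_distrib, Finset.sum_neg_distrib, Finset.sum_add_distrib, Finset.mul_sum, Finset.mul_sum]
  obtain ⟨n, rfl⟩ : ∃ n, k = n + 3 := ⟨k - 3, by omega⟩
  -- the corrections: the first three cells always, the fourth iff `k ≥ 4`
  have hcorr : ∑ j ∈ Finset.range (n + 3), (if j = 0 then -180 * X * ι ^ 2 + 144 * X * ι ^ 3 else if j = 1 then -240 * X ^ 2 * ι ^ 3 + 72 * X ^ 2 * ι ^ 4
        else if j = 2 then -336 * X ^ 3 * ι ^ 4 else if j = 3 then -384 * X ^ 4 * ι ^ 5 else (0 : PowerSeries ℚ)) =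
      (-180 * X * ι ^ 2 + 144 * X * ι ^ 3 - 240 * X ^ 2 * ι ^ 3 + 72 * X ^ 2 * ι ^ 4 - 336 * X ^ 3 * ι ^ 4 - 384 * X ^ 4 * ι ^ 5) +
        (if n = 0 then 384 * X ^ 4 * ι ^ 5 else 0) := by
    rw [Finset.sum_range_succ' _ (n + 2), Finset.sum_range_succ' _ (n + 1), Finset.sum_range_succ' _ n]
    simp only [show ∀ m : ℕ, m + 1 ≠ 0 from fun m => by omega, show ∀ m : ℕ, m + 1 + 1 ≠ 1 from fun m => by omega,
      show ∀ m : ℕ, m + 1 + 1 + 1 ≠ 2 from fun m => by omega, show ∀ m : ℕ, (m + 1 + 1 + 1 = 3 ↔ m = 0) from fun m => by omega,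
      show (0 + 1 + 1 : ℕ) = 2 from rfl, show (0 + 1 : ℕ) = 1 from rfl, if_true, if_false]
    rcases n with _ | n
    · rw [Finset.sum_range_zero, if_pos rfl]; ring
    · rw [Finset.sum_range_succ' _ n, if_neg (by omega : n + 1 ≠ 0)]
      rw [Finset.sum_eq_zero (fun m _ => by rw [if_neg (by omega : m + 1 ≠ 0)])]
      simp only [if_true, zero_add]
      ring
  have g1 := alg5_tele_p w ι (by rw [hw]; ring) (n + 3)
  have g2 := alg5_tele_q w ι (by rw [hw]; ring) (n + 3)
  have hclose := alg5_close X ι hF1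
  rw [hw2] at hclose
  -- `48 ι⁵ (T + 8X⁵(…)ι⁵) = ι² w^{k+1} (R_p + R_q) + [k = 3] 384 X⁴ ι¹⁰`
  apply alg4_dvd_of_dvd_unit_mul 5 48 (by norm_num)
  rw [show PowerSeries.C (48 : ℚ) = 48 from map_ofNat _ 48, ← hι]
  have key : 48 * ι ^ 5 * (T + 8 * X ^ 5 * (2 + 15 * X + 24 * X ^ 2 + 20 * X ^ 3) * ι ^ 5) =
      ι ^ 2 * w ^ (n + 3 + 1) *
        ((-((n + 3 : ℕ) : PowerSeries ℚ) ^ 3 * w ^ 3 + 12 * ((n + 3 : ℕ) : PowerSeries ℚ) ^ 2 * w ^ 3 + 3 * ((n + 3 : ℕ) : PowerSeries ℚ) ^ 3 * w ^ 2 - 59 * ((n + 3 : ℕ) : PowerSeries ℚ) * w ^ 3 - 33 * ((n + 3 : ℕ) : PowerSeries ℚ) ^ 2 * w ^ 2 - 3 * ((n + 3 : ℕ) : PowerSeries ℚ) ^ 3 * w + 150 * ((n + 3 : ℕ) : PowerSeries ℚ) * w ^ 2 + 30 * ((n + 3 : ℕ) : PowerSeries ℚ) ^ 2 * w + ((n +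 3 : ℕ) : PowerSeries ℚ) ^ 3 + 138 * w ^ 3 - 129 * ((n + 3 : ℕ) : PowerSeries ℚ) * w - 9 * ((n + 3 : ℕ) : PowerSeries ℚ) ^ 2 - 342 * w ^ 2 + 38 * ((n + 3 : ℕ) : PowerSeries ℚ) + 300 * w - 90) +
         (((n + 3 : ℕ) : PowerSeries ℚ) ^ 4 * w ^ 4 - 12 * ((n + 3 : ℕ) : PowerSeries ℚ) ^ 3 * w ^ 4 - 4 * ((n + 3 : ℕ) : PowerSeries ℚ) ^ 4 * w ^ 3 + 65 * ((n + 3 : ℕ) : PowerSeries ℚ) ^ 2 * w ^ 4 + 44 * ((n + 3 : ℕ) : PowerSeries ℚ) ^ 3 * w ^ 3 + 6 * ((n + 3 : ℕ) : PowerSeries ℚ) ^ 4 * w ^ 2 - 180 * ((n + 3 : ℕ) : PowerSeries ℚ) * w ^ 4 - 218 * ((n + 3 : ℕ) : PowerSeries ℚ) ^ 2 * w ^ 3 - 60 * ((n + 3 : ℕ) : PowerSeries ℚ) ^ 3 * w ^ 2 - 4 * ((n + 3 : ℕ) : PowerSeries ℚ) ^ 4 * w + 550 * ((n + 3 : ℕ)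 : PowerSeries ℚ) * w ^ 3 + 276 * ((n + 3 : ℕ) : PowerSeries ℚ) ^ 2 * w ^ 2 + 36 * ((n + 3 : ℕ) : PowerSeries ℚ) ^ 3 * w + ((n + 3 : ℕ) : PowerSeries ℚ) ^ 4 + 198 * w ^ 4 - 666 * ((n + 3 : ℕ) : PowerSeries ℚ) * w ^ 2 - 158 * ((n + 3 : ℕ) : PowerSeries ℚ) ^ 2 * w - 8 * ((n + 3 : ℕ) : PowerSeries ℚ) ^ 3 - 534 * w ^ 3 + 378 * ((n + 3 : ℕ) : PowerSeries ℚ) * w + 35 * ((n + 3 : ℕ) : PowerSeries ℚ) ^ 2 + 630 * w ^ 2 - 82 * ((n + 3 : ℕ) : PowerSeries ℚ) - 342 * w + 72)) +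
      ι ^ 5 * (if n = 0 then 384 * X ^ 4 * ι ^ 5 else 0) := by
    have e : 48 * ι ^ 5 * (T + 8 * X ^ 5 * (2 + 15 * X + 24 * X ^ 2 + 20 * X ^ 3) * ι ^ 5) =
        ι ^ 5 * (48 * T) + 384 * X ^ 5 * (2 + 15 * X + 24 * X ^ 2 + 20 * X ^ 3) * ι ^ 10 := by ring
    rw [e, h48T, hcorr]
    push_cast at g1 g2 ⊢
    linear_combination (-(ι ^ 2)) * g1 + (-(ι ^ 2)) * g2 + hclose
  rw [key]
  refine dvd_add ?_ ?_
  · have h1 : X ^ (n + 3 + 1) ∣ w ^ (n + 3 + 1) := pow_dvd_pow_of_dvd hwX _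
    exact dvd_mul_of_dvd_left (dvd_mul_of_dvd_right h1 _) _
  · rcases n with _ | n
    · rw [if_pos rfl]
      exact Dvd.intro (384 * ι ^ 10) (by ring)
    · rw [if_neg (by omega : n + 1 ≠ 0), mul_zero]
      exact dvd_zero _

/-- `[X^k] 4X⁵(1 − 16X + 4X²)ι⁵ = (−1)^{k−1}2^{k−3}(k−3)(k−4)(5k² − 35k + 56)/12` for `k ≥ 3` (`= (−1)^{k−1}2^{k−3}[C(k−1,4) + 8C(k−2,4) + C(k−3,4)]`).
[cite: MadrasSlade1993, §1.1 eq. (1.1.8) p. 5; lane plumbing] -/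
private theorem alg5_coeff_H {k : ℕ} (hk : 3 ≤ k) :
    PowerSeries.coeff k (PowerSeries.C (4 : ℚ) * PowerSeries.X ^ 5 *
      (1 - PowerSeries.C (16 : ℚ) * PowerSeries.X + PowerSeries.C (4 : ℚ) * PowerSeries.X ^ 2) *
      PowerSeries.mk (fun i : ℕ => (-2 : ℚ) ^ i) ^ 5) =
      (-1 : ℚ) ^ (k - 1) * 2 ^ (k - 3) * (((k : ℚ) - 3) * ((k : ℚ) - 4) * (5 * (k : ℚ) ^ 2 - 35 * (k : ℚ) + 56)) / 12 := by
  rw [← alg4_iota_pow 4]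
  set F : PowerSeries ℚ := PowerSeries.mk (fun n : ℕ => (((n + 4).choose 4 : ℕ) : ℚ) * (-2 : ℚ) ^ n) with hF
  have hsplit : PowerSeries.C (4 : ℚ) * PowerSeries.X ^ 5 *
      (1 - PowerSeries.C (16 : ℚ) * PowerSeries.X + PowerSeries.C (4 : ℚ) * PowerSeries.X ^ 2) * F =
      PowerSeries.X ^ 5 * (PowerSeries.C (4 : ℚ) * F) - PowerSeries.X ^ 6 * (PowerSeries.C (64 : ℚ) * F) +
        PowerSeries.X ^ 7 * (PowerSeries.C (16 : ℚ) * F) := by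
    rw [show PowerSeries.C (64 : ℚ) = PowerSeries.C 4 * PowerSeries.C 16 by rw [← map_mul]; norm_num,
      show PowerSeries.C (16 : ℚ) = PowerSeries.C 4 * PowerSeries.C 4 by rw [← map_mul]; norm_num]
    ring
  have hchoose : ∀ n : ℕ, (((n + 4).choose 4 : ℕ) : ℚ) = ((n : ℚ) + 1) * ((n : ℚ) + 2) * ((n : ℚ) + 3) * ((n : ℚ) + 4) / 24 := by
    intro n
    have h := Nat.add_one_mul_choose_eq (n + 3) 3
    have h' := Nat.add_one_mul_choose_eq (n + 2) 2
    have h'' := Nat.add_one_mul_choose_eq (n + 1) 1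
    rw [Nat.choose_one_right] at h''
    have e : (24 : ℚ) * (((n + 4).choose 4 : ℕ) : ℚ) = ((n : ℚ) + 1) * ((n : ℚ) + 2) * ((n : ℚ) + 3) * ((n : ℚ) + 4) := by
      have q1 : ((n + 4 : ℕ) : ℚ) * (((n + 3).choose 3 : ℕ) : ℚ) = (((n + 4).choose 4 : ℕ) : ℚ) * 4 := by exact_mod_cast h
      have q2 : ((n + 3 : ℕ) : ℚ) * (((n + 2).choose 2 : ℕ) : ℚ) = (((n + 3).choose 3 : ℕ) : ℚ) * 3 := by exact_mod_cast h'
      have q3 : ((n + 2 : ℕ) : ℚ) * ((n + 1 : ℕ) : ℚ) = (((n + 2).choose 2 : ℕ) : ℚ) * 2 := by exact_mod_cast h''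
      push_cast at q1 q2 q3
      linear_combination (-6) * q1 - 2 * ((n : ℚ) + 4) * q2 - ((n : ℚ) + 4) * ((n : ℚ) + 3) * q3
    linear_combination e / 24
  rw [hsplit, map_add, map_sub, PowerSeries.coeff_X_pow_mul', PowerSeries.coeff_X_pow_mul', PowerSeries.coeff_X_pow_mul']
  have hm2 : (-2 : ℚ) = (-1) * 2 := by norm_num
  by_cases h7 : 7 ≤ k
  · rw [if_pos (by omega), if_pos (by omega), if_pos h7, PowerSeries.coeff_C_mul, PowerSeries.coeff_C_mul, PowerSeries.coeff_C_mul,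
      hF, PowerSeries.coeff_mk, PowerSeries.coeff_mk, PowerSeries.coeff_mk, hchoose, hchoose, hchoose]
    obtain ⟨m, rfl⟩ : ∃ m, k = m + 7 := ⟨k - 7, by omega⟩
    rw [show m + 7 - 5 = m + 2 by omega, show m + 7 - 6 = m + 1 by omega, Nat.add_sub_cancel, show m + 7 - 1 = m + 6 by omega,
      show m + 7 - 3 = m + 4 by omega, hm2, mul_pow, mul_pow, mul_pow]
    push_cast
    ring
  · by_cases h6 : 6 ≤ k
    · obtain rfl : k = 6 := by omega
      rw [if_pos (by omega), if_pos (by omega), if_neg (by omega), add_zero, PowerSeries.coeff_C_mul, PowerSeries.coeff_C_mul, hF,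
        PowerSeries.coeff_mk, PowerSeries.coeff_mk]
      norm_num [Nat.choose]
    · by_cases h5 : 5 ≤ k
      · obtain rfl : k = 5 := by omega
        rw [if_pos (by omega), if_neg (by omega), if_neg (by omega), add_zero, sub_zero, PowerSeries.coeff_C_mul, hF,
          PowerSeries.coeff_mk]
        norm_num [Nat.choose]
      · rw [if_neg (by omega), if_neg (by omega), if_neg (by omega)]
        rcases (by omega : k = 3 ∨ k = 4) with rfl | rfl
        · norm_num
        · norm_num

/-- The census fourth symbol of the three-step count vanishes: `t(3) = [d⁰] c₃(ℤ^d) = 0` (`c₃ = 2d(2d−1)²`, `count_three_eq`).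
[cite: MadrasSlade1993, §1.1 eq. (1.1.8) p. 5; lane plumbing] -/
private theorem alg5_t_three (t : ℕ → ℚ)
    (ht : ∀ c : ℕ, 3 ≤ c → ∃ P : Polynomial ℚ, P.natDegree ≤ c ∧ P.coeff (c - 3) = t c ∧ ∀ d : ℕ, (count d c : ℚ) = P.eval (d : ℚ)) :
    t 3 = 0 := by
  obtain ⟨P, -, hP, hev⟩ := ht 3 le_rfl
  have hPQ : P = 8 * Polynomial.X ^ 3 - 8 * Polynomial.X ^ 2 + 2 * Polynomial.X := by
    refine alg4_poly_ext fun d => ?_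
    rw [← hev d, count_three_eq]
    rcases d with _ | d
    · simp
    · rw [show 2 * (d + 1) - 1 = 2 * d + 1 by omega]
      push_cast
      simp only [Polynomial.eval_add, Polynomial.eval_sub, Polynomial.eval_mul, Polynomial.eval_pow, Polynomial.eval_X,
        Polynomial.eval_ofNat]
      ring
  rw [← hP, hPQ]
  simp

/-- The census fourth symbol of the four-step count: `t(4) = [d¹] c₄(ℤ^d) = 2` (`c₄ = 2d(2d−1)³ − 2d(2d−2)`, `count_four_eq`).
[cite: MadrasSlade1993, §1.1 eq. (1.1.8) p. 5; lane plumbing] -/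
private theorem alg5_t_four (t : ℕ → ℚ)
    (ht : ∀ c : ℕ, 3 ≤ c → ∃ P : Polynomial ℚ, P.natDegree ≤ c ∧ P.coeff (c - 3) = t c ∧ ∀ d : ℕ, (count d c : ℚ) = P.eval (d : ℚ)) :
    t 4 = 2 := by
  obtain ⟨P, -, hP, hev⟩ := ht 4 (by omega)
  have hPQ : P = 16 * Polynomial.X ^ 4 - 24 * Polynomial.X ^ 3 + 8 * Polynomial.X ^ 2 + 2 * Polynomial.X := by
    refine alg4_poly_ext fun d => ?_
    rw [← hev d, count_four_eq]
    rcases d with _ | d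
    · simp
    · have h1 : 2 * (d + 1) * (2 * (d + 1) - 2) ≤ 2 * (d + 1) * (2 * (d + 1) - 1) ^ 3 := by
        rw [show 2 * (d + 1) - 1 = 2 * d + 1 by omega, show 2 * (d + 1) - 2 = 2 * d by omega]
        exact Nat.mul_le_mul_left _ ((by omega : 2 * d ≤ 2 * d + 1).trans (Nat.le_self_pow (by norm_num) _))
      rw [Nat.cast_sub h1, show 2 * (d + 1) - 1 = 2 * d + 1 by omega, show 2 * (d + 1) - 2 = 2 * d by omega]
      push_cast
      simp only [Polynomial.eval_add, Polynomial.eval_sub, Polynomial.eval_mul, Polynomial.eval_pow, Polynomial.eval_X,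
        Polynomial.eval_ofNat]
      ring
  rw [show (4 : ℕ) - 3 = 1 from rfl] at hP
  rw [← hP, hPQ]
  simp

/-- ★★★ Am. BC's FOURTH-SYMBOL LAW FROM THE TWO CENSUS LAWS: if the census fourth symbols obey the lane's laws (L1)
`t(c) = [d^{c−3}] c_c(ℤ^d) = −(2^{c−4}/3)(c³ − 12c² + 59c − 138)` for `c ≥ 5` and (L2′) `s(c) = [d^{c−3}] N_{c,c+2}(ℤ^{d+1}) =
−(2^{c−3}/6)(c⁴ − 12c³ + 65c² − 180c + 198)` for `c ≥ 4` (stated as `48·t(c) = −2^c(…)`, `48·s(c) = −2^c(…)`; the exceptional values `t(3) = 0`,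
`t(4) = 2` are PROVED from `count_three_eq` / `count_four_eq`), then for every `k ≥ 3`
`[d^{k−3}] c_k^{(d)} = (−1)^{k−1} 2^{k−3} (k − 3)(k − 4)(5k² − 35k + 56)/12` (generating function `4X⁵(1 − 16X + 4X²)(1+2X)⁻⁵`, `alg5_coeff_H`;
the passengers collapse by `alg5_T_law`). The two laws are the lane's blind-verified census laws (FINDING-ZD-FOURTH-SYMBOL §1–§2), NOT proved
here: this theorem REDUCES Am. BC to them. [cite: MadrasSlade1993, §1.1 eq. (1.1.8) p. 5; §4.2 eq. (4.2.20)–(4.2.22)] [cite: ClisbyLiangSlade2007, §1.3 eq. (1)/(3); lane theorem] -/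
theorem exists_polynomial_largeForceCoeffZd_thirdCoeff_of_census_laws (t s : ℕ → ℚ)
    (ht : ∀ c : ℕ, 3 ≤ c → ∃ P : Polynomial ℚ, P.natDegree ≤ c ∧ P.coeff (c - 3) = t c ∧ ∀ d : ℕ, (count d c : ℚ) = P.eval (d : ℚ))
    (hs : ∀ c : ℕ, 4 ≤ c → ∃ P : Polynomial ℚ, P.natDegree ≤ c - 2 ∧ P.coeff (c - 3) = s c ∧
      ∀ d : ℕ, (costCoeffZd d c (c + 2) : ℚ) = P.eval (d : ℚ))
    (htlaw : ∀ c : ℕ, 5 ≤ c → 48 * t c = -(2 : ℚ) ^ c * ((c : ℚ) ^ 3 - 12 * (c : ℚ) ^ 2 + 59 * (c : ℚ) - 138))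
    (hslaw : ∀ c : ℕ, 4 ≤ c → 48 * s c = -(2 : ℚ) ^ c * ((c : ℚ) ^ 4 - 12 * (c : ℚ) ^ 3 + 65 * (c : ℚ) ^ 2 - 180 * (c : ℚ) + 198))
    {k : ℕ} (hk : 3 ≤ k) :
    ∃ P : Polynomial ℚ, P.natDegree = k - 1 ∧ P.leadingCoeff = (-2 : ℚ) ^ (k - 1) ∧
      P.coeff (k - 2) = (-1 : ℚ) ^ (k - 1) * 2 ^ (k - 2) * ((k : ℚ) ^ 2 - 5 * k + 7) ∧
      P.coeff (k - 3) = (-1 : ℚ) ^ (k - 1) * 2 ^ (k - 3) * (((k : ℚ) - 3) * ((k : ℚ) - 4) * (5 * (k : ℚ) ^ 2 - 35 * (k : ℚ) + 56)) / 12 ∧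
      ∀ d : ℕ, (largeForceCoeffZd d k : ℚ) = P.eval (d : ℚ) := by
  obtain ⟨P, hdeg, hlead, hsec, hthird, hev⟩ := exists_polynomial_largeForceCoeffZd_thirdCoeff_series t s ht hs hk
  refine ⟨P, hdeg, hlead, hsec, ?_, hev⟩
  have hT := alg5_T_law t s (alg5_t_three t ht) (alg5_t_four t ht) htlaw hslaw hk
  have hc := (PowerSeries.X_pow_dvd_iff.1 hT) k (Nat.lt_succ_self _)
  rw [map_add, ← eq_neg_iff_add_eq_zero] at hc
  rw [hthird, map_add, hc, ← map_neg, ← map_add, ← alg5_coeff_H hk]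
  congr 1
  rw [show PowerSeries.C (5 : ℚ) = 5 from map_ofNat _ 5, show PowerSeries.C (14 : ℚ) = 14 from map_ofNat _ 14,
    show PowerSeries.C (52 : ℚ) = 52 from map_ofNat _ 52, show PowerSeries.C (40 : ℚ) = 40 from map_ofNat _ 40,
    show PowerSeries.C (16 : ℚ) = 16 from map_ofNat _ 16, show PowerSeries.C (4 : ℚ) = 4 from map_ofNat _ 4]
  ring

end Collapse


end Literature.Probability.RandomPlanarGeometry.SAW.Zd
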